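import Mathlib
import Literature.NumberTheory.LFunctions.Zhang2022.TypedSection16A
import Literature.NumberTheory.LFunctions.Zhang2022.TypedSection17Identities
import Literature.NumberTheory.LFunctions.Zhang2022.Section7KappaEulerLocal
import Literature.NumberTheory.LFunctions.Zhang2022.AppendixAKappa2PrimePowers
import HarnessLib

/-!
# Zhang (2022), typed manuscript, §16 part A — kernel-checked identity leaves and support facts

Theorem-only companion of `TypedSection16A` (Y. Zhang, arXiv:2211.02515v1 (2022) [Zhang2022LandauSiegel],
§16 pp. 88–92 — **an unrefereed manuscript under adjudication**; the claims of §16 are typed, STATED NOT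
ASSERTED, in `TypedSection16A`; this file PROVES those of them that are exact identities of the typed
objects, and records support facts read off the definitions). Campaign D-0069, layer L4, seat L4-t4.

* `step16_u008_holds` — node `Z22:§16.u008`: `K(1−s−β₂,ψ̄) = Σ_n g̃₂(n)ψ̄(n)/n^{1−s}` (unfolding
  `Skeleton.Kchar`, `n^{−(1−s−β₂)} = n^{β₂}n^{−(1−s)}`);
* `step16_u026_holds` — node `Z22:§16.u026` (the `χ(2) = 1` case of `ℳ₂*`, definitional);
* `eq16_6_holds` — node `Z22:(16.6)`: "On substituting `n = mk` we can write
  `𝒟₂(d,l) = Σ_n λ₂(dn)g̃₂(dn)ξ₂(n;d,l)/n`" — the exact regrouping of the finite double sum u019 (terms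
  with `mk > 2P₄` vanish as `g̃₂(mdk) = 0`);
* `step16_u020_holds` — node `Z22:§16.u020` (display): `𝒟₂(d,l) = λ₂(d)Σ_n λ̃₂(n,d)ξ₂(n;d,l)g̃₂(dn)/n`,
  via `lam2_mul` / `lam2_mul_one` (`λ₂(dn) = λ₂(d)λ̃₂(n,d)`: the prime factors of `dn` split disjointly);
* `eq16_u007_holds` — node `Z22:§16.u007`: the typed (χ-twisted) `b1coef` satisfies its defining display
  `Σ_n b₁(n)ψ(n)n^{−s} = B(s,ψ)N(s+β₃,ψ)` (`log D ≥ 10`); `eq16_2_of` — EDGE (16.2) ⇐ Prop 14.1 + u010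
  (bridge `sum_Phi2p_eq_main141`);
* `step16_u020mult_holds` — node `Z22:§16.u020` (prose): "`ξ₂(n;d,l)` is a multiplicative function of
  `n`", via `kappaTilde2_mul_of_coprime` (`κ̃₂(m₁m₂;r,s) = κ̃₂(m₁;r,s)κ̃₂(m₂;r,s)`, coprime `mᵢ`,
  `Re s > 0`; splitting of `𝔫(m₁m₂)` by `KappaEuler.exists_split`/`split_unique`, absolute convergence
  `summable_norm_kappaTilde2_term` by the Euler product over `m.primeFactors`-factored numbers),
  `kappaTilde2_arg_mul_of_coprime`, `kappaTilde2_one_left`, `xi2_one`, `xi2_mul_of_coprime`;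
* `step16_u012_holds` — node `Z22:§16.u012`: for `σ > 1`,
  `Σ_{(l₁,d₂k)=1} κ₂(d₁l₁)χ(l₁)/l₁^s = κ̃₂(d₁;d₂k,s)·λ₂(d₁d₂k,s)·L(s+β₁,χ)/L(s,χ)` — the §7 p.40 mechanism
  (`KappaEuler.exists_split` / `convolution_eq_of_split`: `l = hr`, `h ∈ 𝔫(d₁)`, `(r, d₁m) = 1`),
  `LSeries_convolution'`, the Euler product of `χκ₂` over `𝔫(N)` (`LSeries_indicator_nset_chiKappa`,
  local factor `tsum_kappa2_prime_pow_mul_pow`: `Σ_e κ₂(qᵉ)xᵉ = (1−x)/(1−q^{−ib₁}x)`), `lam2_mul_prod_eq_one`,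
  `MeanSquareMajorant.LSeries_twist_kappa₂` and `DirichletCharacter.LFunction_eq_LSeries`;
* support facts: `vk2_eq_zero_of_le`, `vk3_eq_zero_of_le`, `P2_le_sqrt_bigP`, `bcoef_eq_zero_of_le`
  (`b(m) = 0` for `m ≥ P^{1/2}·max(P₂,P₃)`, sharper than the printed (15.2)), `b1coef_eq_zero_of_le`
  (`b₁(n) = 0` for `n ≥ 2T²P^{1/2}max(P₂,P₃) = 2PT⁻⁸`), `P4_nonneg`, `gTilde16_eq_zero_of_le`, `lam2_prime`,
  `suppBound_le_bigP` (`10 ≤ 𝓛 ⇒ 2T²P^{1/2}max(P₂,P₃) ≤ P`), `convolution_bcoef_nN_eq_b1coef`.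

No new definitions, no named facts. [cite: Zhang2022LandauSiegel, §16]
-/

noncomputable section

open Complex Real ComplexConjugate Filter Topology
open Literature.NumberTheory.LFunctions.Zhang2022
open Literature.NumberTheory.LFunctions.Zhang2022.Skeleton
open Literature.NumberTheory.LFunctions.Zhang2022.Typed.Section16A

namespace Literature.NumberTheory.LFunctions.Zhang2022.Typed.Section16ALeaves

/-! ## Kernel-checked identity leaves (definitional nodes discharged here) -/

section Leaves

variable (c' : ℝ)

/-- **u026 holds** (definitional unfolding of `calM2star` in the case `χ(2) = 1`). Node `Z22:§16.u026`
DISCHARGED. [cite: Zhang2022LandauSiegel, §16 p.92 (u026)] -/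
theorem step16_u026_holds : Step16_u026 c' := by
  intro D _ χ h2 s
  unfold calM2star
  rw [if_neg (not_not.mpr h2)]

/-- `Step16_u026` — `_holds` alias of `step16_u026_holds` above under the fact's exact name (appended
2026-08-28, D-0026 bookkeeping: the proof term is the existing theorem of this file; no statement,
definition or attribute is edited; no new named fact; the ledger's debt table listed the fact
unproved). [cite: Zhang2022LandauSiegel, §16 p.92 (u026)] -/
theorem _root_.Literature.NumberTheory.LFunctions.Zhang2022.Typed.Section16A.Step16_u026_holds :
    Step16_u026 c' :=
  _root_.Literature.NumberTheory.LFunctions.Zhang2022.Typed.Section16ALeaves.step16_u026_holds (c' := c')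

/-- **u008 holds**: `K(1−s−β₂,ψ̄) = Σ_n g̃₂(n)ψ̄(n)/n^{1−s}` by `n^{−(1−s−β₂)} = n^{β₂}·n^{−(1−s)}` termwise
(`Skeleton.Kchar` unfolded). Node `Z22:§16.u008` DISCHARGED. [cite: Zhang2022LandauSiegel, §16 p.89 (u008)] -/
theorem step16_u008_holds : Step16_u008 c' := by
  intro D x s
  unfold Kchar gTilde16
  refine Finset.sum_congr rfl fun n hn => ?_
  have hn1 : 1 ≤ n := (Finset.mem_Ico.mp hn).1
  have hn0 : (n : ℂ) ≠ 0 := by exact_mod_cast Nat.one_le_iff_ne_zero.mp hn1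
  rw [show -(1 - s - beta2 c' D) = beta2 c' D + -(1 - s) by ring, Complex.cpow_add _ _ hn0,
    Complex.cpow_neg]
  push_cast
  ring

/-- `Step16_u008` — `_holds` alias of `step16_u008_holds` above under the fact's exact name (appended
2026-08-28, D-0026 bookkeeping: the proof term is the existing theorem of this file; no statement,
definition or attribute is edited; no new named fact; the ledger's debt table listed the fact
unproved). [cite: Zhang2022LandauSiegel, §16 p.89 (u008)] -/
theorem _root_.Literature.NumberTheory.LFunctions.Zhang2022.Typed.Section16A.Step16_u008_holds :
    Step16_u008 c' :=
  _root_.Literature.NumberTheory.LFunctions.Zhang2022.Typed.Section16ALeaves.step16_u008_holds (c' := c')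

/-! ### Support of `b` and `b₁` from the definitions (range bookkeeping for the finite sums) -/

/-- `ϰ₂(n) = 0` for `n ≥ P₂` (8.6). [cite: Zhang2022LandauSiegel, §8 (8.6)] -/
theorem vk2_eq_zero_of_le {D n : ℕ} (h : Skeleton.P2 D ≤ n) : vk2 D n = 0 := by
  unfold vk2; rw [if_neg (not_lt.mpr h)]

/-- `ϰ₃(n) = 0` for `n ≥ P₃` (8.6). [cite: Zhang2022LandauSiegel, §8 (8.6)] -/
theorem vk3_eq_zero_of_le {D n : ℕ} (h : P3 D ≤ n) : vk3 D n = 0 := by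
  unfold vk3; rw [if_neg (not_lt.mpr h)]

/-- `P₂ = P^{1/2}T⁻¹⁰ ≤ P^{1/2}` (`T = exp{𝓛^{1.1}} ≥ 1`). [cite: Zhang2022LandauSiegel, §2 (2.21)] -/
theorem P2_le_sqrt_bigP (D : ℕ) : Skeleton.P2 D ≤ bigP D ^ (1 / 2 : ℝ) := by
  have hT : 1 ≤ bigT D := by
    unfold bigT
    exact Real.one_le_exp (Real.rpow_nonneg (Real.log_natCast_nonneg D) _)
  have hP : 0 ≤ bigP D ^ (1 / 2 : ℝ) := Real.rpow_nonneg (Real.exp_nonneg _) _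
  unfold Skeleton.P2
  rw [show (0.5 : ℝ) = 1 / 2 by norm_num]
  exact div_le_self hP (one_le_pow₀ hT)

/-- **Support of `b`** (from the definition of `Skeleton.bcoef`, sharper than the printed (15.2)):
`b(m) = 0` once `m ≥ P^{1/2}·max(P₂, P₃)` (`= PT⁻¹⁰` for `D` large): in `b = (ϰ₁1_{<P^{1/2}} + ι₂ϰ₂) ∗
(ῑ₃ϰ₃ + ῑ₄ϰ₂)` a factorisation `m = ac` has `a ≥ P^{1/2}` (first factor `0`) or `c ≥ max(P₂,P₃)`
(second factor `0`). [cite: Zhang2022LandauSiegel, §15 (15.1)–(15.2)] -/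
theorem bcoef_eq_zero_of_le {D m : ℕ}
    (h : bigP D ^ (1 / 2 : ℝ) * max (Skeleton.P2 D) (P3 D) ≤ m) : bcoef D m = 0 := by
  unfold bcoef
  refine Finset.sum_eq_zero fun q hq => ?_
  have hqm : q.1 * q.2 = m := (Nat.mem_divisorsAntidiagonal.mp hq).1
  by_cases ha : (q.1 : ℝ) < bigP D ^ (1 / 2 : ℝ)
  · -- then `q.2 ≥ max(P₂, P₃)`, so the second factor vanishes
    have hb : max (Skeleton.P2 D) (P3 D) ≤ (q.2 : ℝ) := by
      by_contra hlt
      push Not at hlt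
      have h0 : (0 : ℝ) ≤ q.1 := Nat.cast_nonneg _
      have hM : 0 < max (Skeleton.P2 D) (P3 D) := lt_of_le_of_lt (Nat.cast_nonneg _) hlt
      have : (q.1 : ℝ) * q.2 < bigP D ^ (1 / 2 : ℝ) * max (Skeleton.P2 D) (P3 D) :=
        mul_lt_mul'' ha hlt h0 (Nat.cast_nonneg _)
      have hm : (m : ℝ) = (q.1 : ℝ) * q.2 := by exact_mod_cast hqm.symm
      linarith
    rw [vk3_eq_zero_of_le ((le_max_right _ _).trans hb),
      vk2_eq_zero_of_le ((le_max_left _ _).trans hb)]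
    simp
  · -- the first factor vanishes
    rw [if_neg ha, vk2_eq_zero_of_le ((P2_le_sqrt_bigP D).trans (not_lt.mp ha))]
    simp

variable {D : ℕ} (χ : DirichletCharacter ℂ D) in
/-- **Support of `b₁`**: `b₁(n) = 0` once `n ≥ 2T²·P^{1/2}·max(P₂,P₃)` (`= 2PT⁻⁸ < P` for `D` large):
in `b₁ = (l ↦ l^{−β₃}g*(T²/l)) ∗ (bχ)` a factorisation `n = lm` has `l ≥ 2T²` (`g*(T²/l) = 0`, as
`T²/l ≤ 1/2`) or `m ≥ P^{1/2}max(P₂,P₃)` (`b(m) = 0`, `bcoef_eq_zero_of_le`). So the `b₁`-sums of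
§16 are finite and every range `⊇ [1, 2PT⁻⁸)` is faithful to the printed unrestricted `Σ_n`.
[cite: Zhang2022LandauSiegel, §16 p.89 (u007)] -/
theorem b1coef_eq_zero_of_le {n : ℕ}
    (h : 2 * bigT D ^ 2 * (bigP D ^ (1 / 2 : ℝ) * max (Skeleton.P2 D) (P3 D)) ≤ n) :
    b1coef c' χ n = 0 := by
  unfold b1coef
  refine Finset.sum_eq_zero fun q hq => ?_
  have hqn : q.1 * q.2 = n := (Nat.mem_divisorsAntidiagonal.mp hq).1
  have hn0 : n ≠ 0 := (Nat.mem_divisorsAntidiagonal.mp hq).2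
  have hq1 : 0 < q.1 := Nat.pos_of_ne_zero fun h0 => hn0 (by rw [← hqn, h0, zero_mul])
  by_cases hl : (2 : ℝ) * bigT D ^ 2 ≤ q.1
  · -- `g*(T²/l) = 0`
    have hg : gstar D (bigT D ^ 2 / q.1) = 0 := by
      unfold gstar
      rw [if_neg]
      rw [not_lt, div_le_iff₀ (by exact_mod_cast hq1)]
      linarith
    rw [hg]; simp
  · -- `m` is large, so `b(m) = 0`
    push Not at hl
    have hm : bigP D ^ (1 / 2 : ℝ) * max (Skeleton.P2 D) (P3 D) ≤ (q.2 : ℝ) := by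
      by_contra hlt
      push Not at hlt
      have hB : 0 ≤ bigP D ^ (1 / 2 : ℝ) * max (Skeleton.P2 D) (P3 D) := by
        by_contra hneg
        push Not at hneg
        have : (q.2 : ℝ) < 0 := hlt.trans hneg
        exact absurd this (not_lt.mpr (Nat.cast_nonneg _))
      have : (q.1 : ℝ) * q.2 < 2 * bigT D ^ 2 * (bigP D ^ (1 / 2 : ℝ) * max (Skeleton.P2 D) (P3 D)) :=
        mul_lt_mul'' hl hlt (Nat.cast_nonneg _) (Nat.cast_nonneg _)
      have hn : (n : ℝ) = (q.1 : ℝ) * q.2 := by exact_mod_cast hqn.symm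
      linarith
    rw [bcoef_eq_zero_of_le hm]; simp

/-! ### `g̃₂` vanishes beyond `2P₄`; `λ₂(dn) = λ₂(d)λ̃₂(n,d)`; (16.6) and u020 -/

/-- `P₄ ≥ 0`. [cite: Zhang2022LandauSiegel, §6 p.30] -/
theorem P4_nonneg (D : ℕ) : 0 ≤ P4 D := by
  unfold P4 bigP t0
  have : 0 ≤ ell D := Real.log_natCast_nonneg D
  positivity

/-- `g̃₂(y) = 0` for `y ≥ 2P₄` (`g*(P₄/y) = 0` as `P₄/y ≤ 1/2`). [cite: Zhang2022LandauSiegel, §16 p.89 (u009)] -/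
theorem gTilde16_eq_zero_of_le {D : ℕ} {y : ℝ} (hy : 0 < y) (h : 2 * P4 D ≤ y) :
    gTilde16 c' D y = 0 := by
  have hg : gstar D (P4 D / y) = 0 := by
    unfold gstar
    rw [if_neg]
    rw [not_lt, div_le_iff₀ hy]
    linarith
  unfold gTilde16
  rw [hg]; simp

variable {D : ℕ} (χ : DirichletCharacter ℂ D)

/-- For a prime `q`, `λ₂(q,s)` is the single local factor. [cite: Zhang2022LandauSiegel, §16 p.90 (u014)] -/
theorem lam2_prime {q : ℕ} (hq : q.Prime) (s : ℂ) :
    lam2 c' χ q s =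
      (1 - χ (q : ZMod D) * (q : ℂ) ^ (-(s + beta1 c' D))) / (1 - χ (q : ZMod D) * (q : ℂ) ^ (-s)) := by
  unfold lam2
  rw [hq.primeFactors, Finset.prod_singleton]

/-- **`λ₂(dn,s) = λ₂(d,s)·∏_{q∣n,(q,d)=1} λ₂(q,s)`** (`d, n ≥ 1`): the prime factors of `dn` are those of
`d` together with those of `n` coprime to `d`, disjointly; at `s = 1` the second factor is `λ̃₂(n,d)`
(16.8). [cite: Zhang2022LandauSiegel, §16 (16.8) p.91] -/
theorem lam2_mul {d n : ℕ} (hd : d ≠ 0) (hn : n ≠ 0) (s : ℂ) :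
    lam2 c' χ (d * n) s =
      lam2 c' χ d s * ∏ q ∈ n.primeFactors.filter (fun q => Nat.Coprime q d), lam2 c' χ q s := by
  have hsplit : (d * n).primeFactors =
      d.primeFactors ∪ n.primeFactors.filter (fun q => Nat.Coprime q d) := by
    rw [Nat.primeFactors_mul hd hn]
    ext q
    simp only [Finset.mem_union, Finset.mem_filter, Nat.mem_primeFactors]
    constructor
    · rintro (h | h)
      · exact Or.inl h
      · by_cases hqd : q ∣ d
        · exact Or.inl ⟨h.1, hqd, hd⟩
        · exact Or.inr ⟨h, (Nat.Prime.coprime_iff_not_dvd h.1).mpr hqd⟩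
    · rintro (h | h)
      · exact Or.inl h
      · exact Or.inr h.1
  have hdisj : Disjoint d.primeFactors (n.primeFactors.filter (fun q => Nat.Coprime q d)) := by
    rw [Finset.disjoint_left]
    intro q hqd hqn
    rw [Finset.mem_filter] at hqn
    have hq : q.Prime := (Nat.mem_primeFactors.mp hqd).1
    have hdvd : q ∣ d := (Nat.mem_primeFactors.mp hqd).2.1
    exact hq.one_lt.ne' (Nat.Coprime.eq_one_of_dvd hqn.2 hdvd)
  unfold lam2
  rw [hsplit, Finset.prod_union hdisj]
  congr 1
  refine Finset.prod_congr rfl fun q hq => ?_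
  have hqp : q.Prime := (Nat.mem_primeFactors.mp (Finset.mem_filter.mp hq).1).1
  rw [hqp.primeFactors, Finset.prod_singleton]

/-- `λ₂(dn) = λ₂(d)λ̃₂(n,d)` at `s = 1` (the factorisation used at u020). [cite: Zhang2022LandauSiegel, §16 p.91 (u020)] -/
theorem lam2_mul_one {d n : ℕ} (hd : d ≠ 0) (hn : n ≠ 0) :
    lam2 c' χ (d * n) 1 = lam2 c' χ d 1 * lamTilde2 c' χ n d := by
  rw [lam2_mul c' χ hd hn, lamTilde2]

/-- **u020 from (16.6)**: given the regrouping (16.6), `𝒟₂(d,l) = λ₂(d)Σ_n λ̃₂(n,d)ξ₂(n;d,l)g̃₂(dn)/n` by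
`λ₂(dn) = λ₂(d)λ̃₂(n,d)`. EDGE, kernel-checked. [cite: Zhang2022LandauSiegel, §16 p.91 (u020)] -/
theorem step16_u020_of_eq16_6 (h : Eq16_6 c') : Step16_u020 c' := by
  intro D _ χ d l hd hl
  rw [h D χ d l hd hl, Finset.mul_sum]
  refine Finset.sum_congr rfl fun n hn => ?_
  have hn1 : n ≠ 0 := Nat.one_le_iff_ne_zero.mp (Finset.mem_Icc.mp hn).1
  rw [lam2_mul_one c' χ (Nat.one_le_iff_ne_zero.mp hd) hn1]
  ring

/-- The inner reindexing of (16.6) for a fixed `k ≥ 1`: `Σ_{m≤2P₄} a(k)f(k,m) = Σ_{n≤2P₄, k∣n} g(n)b(k)κ̃₂(n/k;dk)`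
(`n = mk`; the terms with `mk > 2P₄` vanish because `g̃₂(mdk) = 0`). [cite: Zhang2022LandauSiegel, §16 (16.6) p.91] -/
theorem eq16_6_inner [NeZero D] (d k : ℕ) (hd : 1 ≤ d) (hk : 1 ≤ k) :
    ∑ m ∈ Finset.Icc 1 ⌊2 * P4 D⌋₊,
        (ArithmeticFunction.moebius k : ℂ) * χ (k : ZMod D) / (Nat.totient k : ℂ) *
          (kappaTilde2 c' χ m (d * k) 1 * lam2 c' χ (m * d * k) 1 *
            gTilde16 c' D ((m * d * k : ℕ) : ℝ) / (m : ℂ)) =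
      ∑ n ∈ (Finset.Icc 1 ⌊2 * P4 D⌋₊).filter (fun n => k ∣ n),
        lam2 c' χ (d * n) 1 * gTilde16 c' D ((d * n : ℕ) : ℝ) / (n : ℂ) *
          ((ArithmeticFunction.moebius k : ℂ) * χ (k : ZMod D) * (k : ℂ) / (Nat.totient k : ℂ) *
            kappaTilde2 c' χ (n / k) (d * k) 1) := by
  set N := ⌊2 * P4 D⌋₊ with hN
  have hk0 : 0 < k := hk
  -- the `n` with `k ∣ n` in `[1, N]` are the `mk` with `m ∈ [1, N]`, `mk ≤ N`
  have himg : (Finset.Icc 1 N).filter (fun n => k ∣ n) =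
      ((Finset.Icc 1 N).filter (fun m => m * k ≤ N)).image (fun m => m * k) := by
    ext n
    simp only [Finset.mem_filter, Finset.mem_Icc, Finset.mem_image]
    constructor
    · rintro ⟨⟨hn1, hnN⟩, ⟨m, rfl⟩⟩
      have hm0 : 0 < m := Nat.pos_of_ne_zero (by rintro rfl; simp at hn1)
      refine ⟨m, ⟨⟨hm0, le_trans (Nat.le_mul_of_pos_left m hk0) hnN⟩, ?_⟩, by ring⟩
      rw [mul_comm]; exact hnN
    · rintro ⟨m, ⟨⟨hm1, _⟩, hmk⟩, rfl⟩
      exact ⟨⟨le_trans hm1 (Nat.le_mul_of_pos_right m hk0), hmk⟩, Dvd.intro_left m rfl⟩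
  have hinj : ∀ x ∈ (Finset.Icc 1 N).filter (fun m => m * k ≤ N),
      ∀ y ∈ (Finset.Icc 1 N).filter (fun m => m * k ≤ N), x * k = y * k → x = y :=
    fun x _ y _ hxy => Nat.eq_of_mul_eq_mul_right hk0 hxy
  rw [himg, Finset.sum_image hinj]
  -- drop the `m` with `mk > N` from the left sum: their terms vanish
  refine (Finset.sum_filter_of_ne (s := Finset.Icc 1 N) (p := fun m => m * k ≤ N) ?_).symm.trans ?_
  · intro m hm hne
    by_contra hgt
    push Not at hgt
    apply hne
    have hm1 : 1 ≤ m := (Finset.mem_Icc.mp hm).1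
    have hlt : 2 * P4 D < ((m * d * k : ℕ) : ℝ) := by
      have h1 : N < m * d * k :=
        lt_of_lt_of_le hgt (Nat.mul_le_mul_right k (Nat.le_mul_of_pos_right m hd))
      exact (Nat.floor_lt (mul_nonneg zero_le_two (P4_nonneg D))).mp h1
    have hpos : (0 : ℝ) < ((m * d * k : ℕ) : ℝ) := by
      exact_mod_cast Nat.mul_pos (Nat.mul_pos hm1 hd) hk0
    rw [gTilde16_eq_zero_of_le c' hpos hlt.le]
    simp
  · refine Finset.sum_congr rfl fun m hm => ?_
    have hm1 : 1 ≤ m := (Finset.mem_Icc.mp (Finset.mem_filter.mp hm).1).1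
    have hmC : (m : ℂ) ≠ 0 := by exact_mod_cast (Nat.one_le_iff_ne_zero.mp hm1)
    have hkC : (k : ℂ) ≠ 0 := by exact_mod_cast hk0.ne'
    have hφ : (Nat.totient k : ℂ) ≠ 0 := by exact_mod_cast (Nat.totient_pos.mpr hk0).ne'
    rw [Nat.mul_div_cancel m hk0, show d * (m * k) = m * d * k by ring]
    push_cast
    field_simp

/-- **(16.6) holds**: "On substituting `n = mk` …" — the exact regrouping of the finite double sum defining
`𝒟₂(d,l)` (u019) by `n = mk`. Node `Z22:(16.6)` DISCHARGED (kernel). [cite: Zhang2022LandauSiegel, §16 (16.6) p.91] -/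
theorem eq16_6_holds : Eq16_6 c' := by
  intro D _ χ d l hd hl
  unfold calD2 xi2
  simp_rw [Finset.mul_sum]
  have hcomm : ∀ n k : ℕ,
      n ∈ Finset.Icc 1 ⌊2 * P4 D⌋₊ ∧ k ∈ n.divisors.filter (fun k => Nat.Coprime k l) ↔
        n ∈ (Finset.Icc 1 ⌊2 * P4 D⌋₊).filter (fun n => k ∣ n) ∧
          k ∈ (Finset.Icc 1 ⌊2 * P4 D⌋₊).filter (fun k => Nat.Coprime k l) := by
    intro n k
    simp only [Finset.mem_filter, Finset.mem_Icc, Nat.mem_divisors]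
    constructor
    · rintro ⟨⟨hn1, hnN⟩, ⟨hkn, hn0⟩, hcop⟩
      have hk0 : 0 < k := Nat.pos_of_dvd_of_pos hkn hn1
      exact ⟨⟨⟨hn1, hnN⟩, hkn⟩, ⟨hk0, le_trans (Nat.le_of_dvd hn1 hkn) hnN⟩, hcop⟩
    · rintro ⟨⟨⟨hn1, hnN⟩, hkn⟩, ⟨_, _⟩, hcop⟩
      exact ⟨⟨hn1, hnN⟩, ⟨hkn, by omega⟩, hcop⟩
  rw [Finset.sum_comm' hcomm]
  refine Finset.sum_congr rfl fun k hk => ?_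
  have hk1 : 1 ≤ k := (Finset.mem_Icc.mp (Finset.mem_filter.mp hk).1).1
  exact eq16_6_inner c' χ d k hd hk1

/-- `Eq16_6` — `_holds` alias of `eq16_6_holds` above under the fact's exact name (appended
2026-08-28, D-0026 bookkeeping: the proof term is the existing theorem of this file; no statement,
definition or attribute is edited; no new named fact; the ledger's debt table listed the fact
unproved). [cite: Zhang2022LandauSiegel, §16 (16.6) p.91] -/
theorem _root_.Literature.NumberTheory.LFunctions.Zhang2022.Typed.Section16A.Eq16_6_holds :
    Eq16_6 c' :=
  _root_.Literature.NumberTheory.LFunctions.Zhang2022.Typed.Section16ALeaves.eq16_6_holds (c' := c')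

/-- **u020 holds** ((16.6) + `λ₂(dn) = λ₂(d)λ̃₂(n,d)`). Node `Z22:§16.u020` (display) DISCHARGED (kernel);
the multiplicativity sentence `Step16_u020mult` is `step16_u020mult_holds` below. [cite: Zhang2022LandauSiegel, §16 p.91 (u020)] -/
theorem step16_u020_holds : Step16_u020 c' := step16_u020_of_eq16_6 c' (eq16_6_holds c')

/-- `Step16_u020` — `_holds` alias of `step16_u020_holds` above under the fact's exact name (appended
2026-08-28, D-0026 bookkeeping: the proof term is the existing theorem of this file; no statement,
definition or attribute is edited; no new named fact; the ledger's debt table listed the fact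
unproved). [cite: Zhang2022LandauSiegel, §16 p.91 (u020)] -/
theorem _root_.Literature.NumberTheory.LFunctions.Zhang2022.Typed.Section16A.Step16_u020_holds :
    Step16_u020 c' :=
  _root_.Literature.NumberTheory.LFunctions.Zhang2022.Typed.Section16ALeaves.step16_u020_holds (c' := c')

end Leaves

/-! ## u007: the defining identity of `b₁` holds for the typed (χ-twisted) `b1coef` -/

section Bone

open scoped LSeries.notation

variable (c' : ℝ) {D : ℕ} (χ : DirichletCharacter ℂ D) (x : Chr D)

/-- `ψ` is completely multiplicative on `ℕ`. [folklore] -/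
private theorem psiFn_mul (a b : ℕ) : psiFn x (a * b) = psiFn x a * psiFn x b := by
  simp [psiFn, Nat.cast_mul, map_mul]

/-- **`b₁·ψ = (b·ψχ) ∗ (n^{−β₃}g*(T²/n)·ψ)`** pointwise: the typed `b1coef` (χ-twisted) IS the Dirichlet
convolution of the `ψ`-coefficients of `B(s,ψ)` (`= b(m)ψχ(m)`, (15.1)) with those of `N(s+β₃,ψ)`
(`= l^{−β₃}g*(T²/l)ψ(l)` = `Typed.Section17.nN`), `ψ` being completely multiplicative.
[cite: Zhang2022LandauSiegel, §16 p.89 (u007)] -/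
theorem convolution_bcoef_nN_eq_b1coef [NeZero D] :
    (fun n => bcoef D n * pc χ x n) ⍟ (fun n => Typed.Section17.nN D (beta3 c' D) n * psiFn x n) =
      fun n => b1coef c' χ n * psiFn x n := by
  ext n
  rw [LSeries.convolution_def]
  simp only
  unfold b1coef Typed.Section17.nN
  rw [Finset.sum_mul]
  conv_lhs => rw [← Nat.map_swap_divisorsAntidiagonal, Finset.sum_map]
  refine Finset.sum_congr rfl fun q hq => ?_
  have hqn : q.1 * q.2 = n := (Nat.mem_divisorsAntidiagonal.mp hq).1
  simp only [Equiv.coe_toEmbedding, Equiv.prodComm_apply, Prod.fst_swap, Prod.snd_swap]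
  rw [← hqn, psiFn_mul, pc]
  simp only [psiFn]
  ring

omit χ in
/-- The `ψ`-coefficients of `N(s+β,ψ)` have an everywhere summable `L`-series (finite support).
[folklore] -/
private theorem LSeriesSummable_nN_psi (β s : ℂ) :
    LSeriesSummable (fun n => Typed.Section17.nN D β n * psiFn x n) s := by
  refine summable_of_ne_finset_zero (s := Finset.range ⌈2 * bigT D ^ 2⌉₊) fun n hn => ?_
  have hn' : ⌈2 * bigT D ^ 2⌉₊ ≤ n := by simpa using hn
  rcases eq_or_ne n 0 with rfl | h0
  · simp [LSeries.term]
  · have hreal : 2 * bigT D ^ 2 ≤ (n : ℝ) := le_trans (Nat.le_ceil _) (by exact_mod_cast hn')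
    rw [LSeries.term_of_ne_zero h0, Typed.Section17.nN_eq_zero_of_le D β hreal, zero_mul, zero_div]

omit χ x in
/-- **Numerics of the support**: for `log D ≥ 10`, `2T²·P^{1/2}·max(P₂,P₃) ≤ P` (indeed
`2T²P^{1/2}P₂ = 2PT⁻⁸ ≤ P` as `T ≥ e`, and `2T²P^{1/2}P₃ = 2T²P^{0.998} ≤ P` as `2e^{2𝓛^{1.1}+1} ≤
e^{0.002𝓛⁹}`), so that `b₁(n) = 0` for `n ≥ P` (`b1coef_eq_zero_of_le`). [cite: Zhang2022LandauSiegel, §16 p.89 (u007)] -/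
theorem suppBound_le_bigP (hℓ : 10 ≤ ell D) :
    2 * bigT D ^ 2 * (bigP D ^ (1 / 2 : ℝ) * max (Skeleton.P2 D) (P3 D)) ≤ bigP D := by
  have hℓ1 : 1 ≤ ell D := by linarith
  have hℓ0 : 0 ≤ ell D := by linarith
  have hP0 : 0 < bigP D := Real.exp_pos _
  have hT0 : 0 < bigT D := Real.exp_pos _
  -- `a = 𝓛^{1.1}`: `1 ≤ a ≤ 𝓛²`
  have ha1 : 1 ≤ ell D ^ (1.1 : ℝ) := Real.one_le_rpow hℓ1 (by norm_num)
  have ha2 : ell D ^ (1.1 : ℝ) ≤ ell D ^ 2 := by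
    have h := Real.rpow_le_rpow_of_exponent_le hℓ1 (show (1.1 : ℝ) ≤ 2 by norm_num)
    rwa [Real.rpow_two] at h
  -- `T ≥ 2`, hence `T⁸ ≥ 2`
  have hT2 : 2 ≤ bigT D := by
    unfold bigT
    have h1 : Real.exp 1 ≤ Real.exp (ell D ^ (1.1 : ℝ)) := Real.exp_le_exp.mpr ha1
    linarith [Real.add_one_le_exp (1 : ℝ)]
  have hT8 : 2 ≤ bigT D ^ 8 := by
    calc (2 : ℝ) ≤ 2 ^ 8 := by norm_num
      _ ≤ bigT D ^ 8 := by gcongr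
  -- first product: `2T²P^{1/2}P₂ = 2P/T⁸ ≤ P`
  have hhalf : bigP D ^ (1 / 2 : ℝ) * bigP D ^ (0.5 : ℝ) = bigP D := by
    rw [← Real.rpow_add hP0]; norm_num
  have hA1 : 2 * bigT D ^ 2 * (bigP D ^ (1 / 2 : ℝ) * Skeleton.P2 D) ≤ bigP D := by
    unfold Skeleton.P2
    have hT10 : 0 < bigT D ^ 10 := by positivity
    have e1 : 2 * bigT D ^ 2 * (bigP D ^ (1 / 2 : ℝ) * (bigP D ^ (0.5 : ℝ) / bigT D ^ 10)) =
        2 * bigP D / bigT D ^ 8 := by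
      rw [show bigP D ^ (1 / 2 : ℝ) * (bigP D ^ (0.5 : ℝ) / bigT D ^ 10) =
          bigP D ^ (1 / 2 : ℝ) * bigP D ^ (0.5 : ℝ) / bigT D ^ 10 by ring, hhalf]
      field_simp
    rw [e1, div_le_iff₀ (by positivity)]
    nlinarith
  -- second product: `2T²P^{1/2}P₃ = 2T²P^{0.998} ≤ P^{0.998}P^{0.002} = P`
  have h998 : bigP D ^ (1 / 2 : ℝ) * bigP D ^ (0.498 : ℝ) = bigP D ^ (0.998 : ℝ) := by
    rw [← Real.rpow_add hP0]; norm_num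
  have hsplit : bigP D = bigP D ^ (0.998 : ℝ) * bigP D ^ (0.002 : ℝ) := by
    rw [← Real.rpow_add hP0]; norm_num
  have hT2e : 2 * bigT D ^ 2 ≤ bigP D ^ (0.002 : ℝ) := by
    have eT : bigT D ^ 2 = Real.exp (2 * ell D ^ (1.1 : ℝ)) := by
      unfold bigT; rw [← Real.exp_nat_mul]; norm_num
    have eP : bigP D ^ (0.002 : ℝ) = Real.exp (ell D ^ 9 * 0.002) := by
      unfold bigP; rw [Real.exp_mul]
    rw [eT, eP]
    have h2 : (2 : ℝ) ≤ Real.exp 1 := by linarith [Real.add_one_le_exp (1 : ℝ)]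
    have hexp : Real.exp 1 * Real.exp (2 * ell D ^ (1.1 : ℝ)) ≤ Real.exp (ell D ^ 9 * 0.002) := by
      rw [← Real.exp_add, Real.exp_le_exp]
      have h7 : (10 : ℝ) ^ 7 ≤ ell D ^ 7 := by gcongr
      have h9 : ell D ^ 9 = ell D ^ 7 * ell D ^ 2 := by ring
      nlinarith [pow_nonneg hℓ0 2]
    calc 2 * Real.exp (2 * ell D ^ (1.1 : ℝ))
        ≤ Real.exp 1 * Real.exp (2 * ell D ^ (1.1 : ℝ)) := by gcongr
      _ ≤ Real.exp (ell D ^ 9 * 0.002) := hexp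
  have hA2 : 2 * bigT D ^ 2 * (bigP D ^ (1 / 2 : ℝ) * P3 D) ≤ bigP D := by
    unfold P3
    rw [h998]
    calc 2 * bigT D ^ 2 * bigP D ^ (0.998 : ℝ)
        ≤ bigP D ^ (0.002 : ℝ) * bigP D ^ (0.998 : ℝ) := by
          gcongr
      _ = bigP D := by rw [mul_comm, ← hsplit]
  -- combine over the `max`
  rcases le_total (Skeleton.P2 D) (P3 D) with h | h
  · rw [max_eq_right h]; exact hA2
  · rw [max_eq_left h]; exact hA1

/-- **u007 holds** (kernel): "`Σ_n b₁(n)ψ(n)n^{−s} = B(s,ψ)N(s+β₃,ψ)`" for the typed χ-twisted `b1coef`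
and the banked `Bpoly`, `Nchar` — for every real primitive `χ` to a modulus `D` with `log D ≥ 10`
(so that the support of `b₁` sits below `P`), every `ψ ∈ Ψ` and every `s`. Uses the §17 companion's
`Bpoly_eq_LSeries` ((15.1) for the banked `b`), `Nchar_shift_eq_LSeries` and Mathlib's
`LSeries_convolution'`. This settles in the kernel that the ruling-G-L4t1-1/RULING-8 reading of `b₁`
(with the factor `χ(m)`) is exactly what display u007 defines. Node `Z22:§16.u007` (identity part)
DISCHARGED. [cite: Zhang2022LandauSiegel, §16 p.89 (u007)] -/
theorem eq16_u007_holds : Eq16_u007 c' := by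
  refine ⟨⌈Real.exp 10⌉₊, fun D _ χ hD _ _ x s => ?_⟩
  have hℓ : 10 ≤ ell D := by
    have h : Real.exp 10 ≤ D := le_trans (Nat.le_ceil _) (by exact_mod_cast hD)
    exact (Real.le_log_iff_exp_le (lt_of_lt_of_le (Real.exp_pos _) h)).mpr h
  -- right side as one `L`-series
  rw [Typed.Section17.Bpoly_eq_LSeries x χ s, Typed.Section17.Nchar_shift_eq_LSeries x (beta3 c' D) s,
    ← LSeries_convolution' (Typed.Section17.LSeriesSummable_bcoef x χ s)
      (LSeriesSummable_nN_psi x (beta3 c' D) s),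
    convolution_bcoef_nN_eq_b1coef c' χ x]
  -- left side: the finite sum is that `L`-series (support of `b₁` below `⌈P⌉`)
  rw [LSeries]
  symm
  rw [tsum_eq_sum (s := Finset.Ico 1 ⌈bigP D⌉₊)]
  · refine Finset.sum_congr rfl fun n hn => ?_
    have hn1 : 1 ≤ n := (Finset.mem_Ico.mp hn).1
    rw [LSeries.term_of_ne_zero (by omega), psiFn, div_eq_mul_inv, Complex.cpow_neg]
  · intro n hn
    rcases eq_or_ne n 0 with rfl | h0
    · simp [LSeries.term]
    · have hge : ⌈bigP D⌉₊ ≤ n := by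
        by_contra hlt
        exact hn (Finset.mem_Ico.mpr ⟨Nat.one_le_iff_ne_zero.mpr h0, not_le.mp hlt⟩)
      have hreal : 2 * bigT D ^ 2 * (bigP D ^ (1 / 2 : ℝ) * max (Skeleton.P2 D) (P3 D)) ≤ (n : ℝ) :=
        (suppBound_le_bigP hℓ).trans (le_trans (Nat.le_ceil _) (by exact_mod_cast hge))
      rw [LSeries.term_of_ne_zero h0, b1coef_eq_zero_of_le c' χ hreal, zero_mul, zero_div]

/-- `Eq16_u007` — `_holds` alias of `eq16_u007_holds` above under the fact's exact name (appended
2026-08-28, D-0026 bookkeeping: the proof term is the existing theorem of this file; no statement,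
definition or attribute is edited; no new named fact; the ledger's debt table listed the fact
unproved). [cite: Zhang2022LandauSiegel, §16 p.89 (u007)] -/
theorem _root_.Literature.NumberTheory.LFunctions.Zhang2022.Typed.Section16A.Eq16_u007_holds :
    Eq16_u007 c' :=
  _root_.Literature.NumberTheory.LFunctions.Zhang2022.Typed.Section16ALeaves.eq16_u007_holds (c' := c')

end Bone

/-! ## (16.2) from Proposition 14.1 and u010: the bridge to `Skeleton.main141` and the edge -/

section EqTwo

variable (c' : ℝ) {D : ℕ} [NeZero D] (χ : DirichletCharacter ℂ D)

omit [NeZero D] in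
/-- **`Σ_{p∼P}(pt₀)^{β₁}Φ₂(p)` IS the main term of Proposition 14.1** at `β = β₁`, `𝐤* = κ₂*`,
`𝐚* = g̃₂` (exchange of the two finite sums in (16.3); `Skeleton.main141`). [cite: Zhang2022LandauSiegel, §16 (16.2)–(16.3) p.89] -/
theorem sum_Phi2p_eq_main141 :
    ∑ p ∈ primeWindow D, (((p : ℝ) * t0 D : ℝ) : ℂ) ^ beta1 c' D * Phi2p c' χ p =
      main141 χ (beta1 c' D) (kappa2Star c' χ) (fun n => gTilde16 c' D n) := by
  unfold main141 Phi2p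
  rw [Finset.mul_sum]
  refine Finset.sum_congr rfl fun p _ => ?_
  simp only [Finset.mul_sum]
  rw [Finset.sum_comm]
  refine Finset.sum_congr rfl fun d _ => Finset.sum_congr rfl fun k _ => ?_
  have ht : (∑' l : ℕ, if Nat.Coprime l k then
        kappa2Star c' χ (d * l) * χ (l : ZMod D) * DeltaW D ((l : ℝ) / ((D : ℝ) * p * k)) else 0) =
      ∑' l : ℕ, if Nat.Coprime l k then
        χ (l : ZMod D) * kappa2Star c' χ (d * l) * DeltaW D ((l : ℝ) / ((D : ℝ) * p * k)) else 0 := by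
    refine tsum_congr fun l => ?_
    split_ifs
    · ring
    · rfl
  rw [ht]
  ring

/-- **(16.2) ⇐ Proposition 14.1 + u010** (the printed "It follows by Proposition 14.1 that …"), given
the hypotheses under which Proposition 14.1 is invoked: `|β₁| < 5α`, `κ₂* ≪ τ₅`, `g̃₂ ≪ 1` (the support
condition `g̃₂(n) = 0` for `n > 2P₄` is `gTilde16_eq_zero_of_le`). EDGE, kernel-checked; the two majorant
hypotheses are (14.1)/(14.2) for this instance and are left to the discharge lane.
[cite: Zhang2022LandauSiegel, §16 (16.2) p.89] -/
theorem eq16_2_of (h141 : Prop141) (h010 : Step16_u010 c')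
    (hβ : ForAllLarge fun D _ _ => ‖beta1 c' D‖ < 5 * alpha D)
    (hB : ∃ B : ℝ, ForAllLarge fun D _ χ =>
      (∀ m : ℕ, ‖kappa2Star c' χ m‖ ≤ B * ((ArithmeticFunction.zeta ^ 5 : ArithmeticFunction ℕ) m : ℝ)) ∧
        ∀ n : ℕ, ‖gTilde16 c' D n‖ ≤ B) :
    Eq16_2 c' := by
  intro ε hε
  obtain ⟨B, hBD⟩ := hB
  have hε2 : 0 < ε / 2 := by positivity
  obtain ⟨D₀, h⟩ := (((h141 B (ε / 2) hε2).and (h010 (ε / 2) hε2)).and hβ).and hBD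
  refine ⟨D₀, fun D _ χ hD hq hp hA => ?_⟩
  obtain ⟨⟨⟨e141, e010⟩, eβ⟩, eκ, ea⟩ := h D χ hD hq hp
  have hsupp : ∀ n : ℕ, 2 * P4 D < n → gTilde16 c' D n = 0 := fun n hn =>
    gTilde16_eq_zero_of_le c' (lt_of_le_of_lt (mul_nonneg zero_le_two (P4_nonneg D)) hn) hn.le
  have g141 := e141 hA (beta1 c' D) eβ (kappa2Star c' χ) (fun n => gTilde16 c' D n) eκ ea hsupp
  have g010 := e010 hA
  rw [sum_Phi2p_eq_main141]
  calc ‖Phi2 c' χ - main141 χ (beta1 c' D) (kappa2Star c' χ) fun n => gTilde16 c' D n‖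
      = ‖(Phi2 c' χ - Theta2 χ (beta1 c' D) (kappa2Star c' χ) fun n => gTilde16 c' D n) +
          (Theta2 χ (beta1 c' D) (kappa2Star c' χ) (fun n => gTilde16 c' D n) -
            main141 χ (beta1 c' D) (kappa2Star c' χ) fun n => gTilde16 c' D n)‖ := by
        congr 1; ring
    _ ≤ ‖Phi2 c' χ - Theta2 χ (beta1 c' D) (kappa2Star c' χ) fun n => gTilde16 c' D n‖ +
          ‖Theta2 χ (beta1 c' D) (kappa2Star c' χ) (fun n => gTilde16 c' D n) -
            main141 χ (beta1 c' D) (kappa2Star c' χ) fun n => gTilde16 c' D n‖ := norm_add_le _ _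
    _ ≤ ε / 2 * frakP D + ε / 2 * frakP D := add_le_add g010 g141
    _ = ε * frakP D := by ring

end EqTwo

/-! ## u020 (prose): `ξ₂(n;d,l)` is multiplicative in `n` — the structure of `κ̃₂` over `𝔫(m)` -/

section Mult

variable (c' : ℝ) {D : ℕ} (χ : DirichletCharacter ℂ D)

/-! ### `𝔫(m)`: membership, products and splittings along coprime `m₁m₂` -/

/-- `𝔫(m)` (`m ≥ 1`) is Mathlib's set of `m.primeFactors`-factored numbers. [folklore] -/
private theorem mem_nset_iff_factoredNumbers {m h : ℕ} (hm : m ≠ 0) :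
    h ∈ nset m ↔ h ∈ Nat.factoredNumbers m.primeFactors := by
  rw [Nat.mem_factoredNumbers_iff_primeFactors_subset]
  constructor
  · rintro ⟨hpos, hdiv⟩
    refine ⟨hpos.ne', fun q hq => ?_⟩
    have hq' := Nat.mem_primeFactors.mp hq
    exact Nat.mem_primeFactors.mpr ⟨hq'.1, hdiv q hq'.1 hq'.2.1, hm⟩
  · rintro ⟨h0, hsub⟩
    refine ⟨Nat.pos_of_ne_zero h0, fun q hq hqh => ?_⟩
    exact (Nat.mem_primeFactors.mp (hsub (Nat.mem_primeFactors.mpr ⟨hq, hqh, h0⟩))).2.1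

/-- `m ∈ 𝔫(m)` for `m ≥ 1`. [folklore] -/
private theorem self_mem_nset {m : ℕ} (hm : m ≠ 0) : m ∈ nset m :=
  ⟨Nat.pos_of_ne_zero hm, fun _ _ h => h⟩

/-- If `h ∈ 𝔫(m)` and `(m,k) = 1` then `(h,k) = 1`. [folklore] -/
private theorem coprime_of_mem_nset {m h k : ℕ} (hh : h ∈ nset m) (hmk : Nat.Coprime m k) :
    Nat.Coprime h k := by
  refine Nat.coprime_of_dvd fun q hq hqh hqk => ?_
  have hqm : q ∣ m := hh.2 q hq hqh
  have h1 : q ∣ Nat.gcd m k := Nat.dvd_gcd hqm hqk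
  rw [hmk.gcd_eq_one] at h1
  exact hq.one_lt.ne' (Nat.dvd_one.mp h1)

/-- If `h₁ ∈ 𝔫(m₁)`, `h₂ ∈ 𝔫(m₂)` and `(m₁,m₂) = 1` then `(h₁,h₂) = 1`. [folklore] -/
private theorem coprime_of_mem_nset_of_mem_nset {m₁ m₂ h₁ h₂ : ℕ} (h1 : h₁ ∈ nset m₁)
    (h2 : h₂ ∈ nset m₂) (hcop : Nat.Coprime m₁ m₂) : Nat.Coprime h₁ h₂ :=
  coprime_of_mem_nset h1 (coprime_of_mem_nset h2 hcop.symm).symm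

/-- `𝔫(m₁)·𝔫(m₂) ⊆ 𝔫(m₁m₂)`. [folklore] -/
private theorem mul_mem_nset {m₁ m₂ h₁ h₂ : ℕ} (h1 : h₁ ∈ nset m₁) (h2 : h₂ ∈ nset m₂) :
    h₁ * h₂ ∈ nset (m₁ * m₂) := by
  refine ⟨Nat.mul_pos h1.1 h2.1, fun q hq hqh => ?_⟩
  rcases (Nat.Prime.dvd_mul hq).mp hqh with h | h
  · exact dvd_mul_of_dvd_left (h1.2 q hq h) _
  · exact dvd_mul_of_dvd_right (h2.2 q hq h) _

/-- For `h ∈ 𝔫(m)`, `mh` has the same prime factors as `m` (`m ≥ 1`). [folklore] -/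
private theorem primeFactors_mul_eq_of_mem_nset {m h : ℕ} (hm : m ≠ 0) (hh : h ∈ nset m) :
    (m * h).primeFactors = m.primeFactors := by
  rw [Nat.primeFactors_mul hm hh.1.ne', Finset.union_eq_left]
  intro q hq
  have hq' := Nat.mem_primeFactors.mp hq
  exact Nat.mem_primeFactors.mpr ⟨hq'.1, hh.2 q hq'.1 hq'.2.1, hm⟩

/-- An element of `𝔫(m₂)` is free of the primes of `m₁` when `(m₁,m₂) = 1`. [folklore] -/
private theorem not_dvd_of_mem_nset {m₁ m₂ b q : ℕ} (hb : b ∈ nset m₂) (hcop : Nat.Coprime m₁ m₂)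
    (hq : q ∈ m₁.primeFactors) : ¬ q ∣ b := by
  intro hqb
  have hq' := Nat.mem_primeFactors.mp hq
  have hqm₂ : q ∣ m₂ := hb.2 q hq'.1 hqb
  have h1 : q ∣ Nat.gcd m₁ m₂ := Nat.dvd_gcd hq'.2.1 hqm₂
  rw [hcop.gcd_eq_one] at h1
  exact hq'.1.one_lt.ne' (Nat.dvd_one.mp h1)

/-- **Splitting of `𝔫(m₁m₂)`** (`m₁ ≥ 1`): every `h ∈ 𝔫(m₁m₂)` is `h₁h₂` with `hᵢ ∈ 𝔫(mᵢ)` (the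
splitting of `KappaEuler.exists_split` along the primes of `m₁`). [folklore] -/
private theorem exists_split_nset {m₁ m₂ h : ℕ} (hm₁ : m₁ ≠ 0) (hh : h ∈ nset (m₁ * m₂)) :
    ∃ h₁ h₂ : ℕ, h₁ * h₂ = h ∧ h₁ ∈ nset m₁ ∧ h₂ ∈ nset m₂ := by
  obtain ⟨a, b, hab, ha, hb⟩ := KappaEuler.exists_split m₁.primeFactors hh.1.ne'
  refine ⟨a, b, hab, (mem_nset_iff_factoredNumbers hm₁).mpr ha, ?_⟩
  have hb0 : 0 < b := Nat.pos_of_ne_zero (by rintro rfl; exact hh.1.ne' (by rw [← hab, mul_zero]))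
  refine ⟨hb0, fun q hq hqb => ?_⟩
  have hqh : q ∣ h := hab ▸ dvd_mul_of_dvd_right hqb a
  rcases (Nat.Prime.dvd_mul hq).mp (hh.2 q hq hqh) with h1 | h2
  · exact absurd hqb (hb q (Nat.mem_primeFactors.mpr ⟨hq, h1, hm₁⟩) hq)
  · exact h2

/-- **Uniqueness of the splitting** `h = h₁h₂`, `hᵢ ∈ 𝔫(mᵢ)` (`(m₁,m₂) = 1`, `m₁ ≥ 1`). [folklore] -/
private theorem split_nset_unique {m₁ m₂ a b a' b' : ℕ} (hm₁ : m₁ ≠ 0) (hcop : Nat.Coprime m₁ m₂)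
    (ha : a ∈ nset m₁) (hb : b ∈ nset m₂) (ha' : a' ∈ nset m₁) (hb' : b' ∈ nset m₂)
    (heq : a * b = a' * b') : a = a' ∧ b = b' := by
  have hl : a * b ≠ 0 := Nat.mul_ne_zero ha.1.ne' hb.1.ne'
  exact KappaEuler.split_unique (S := m₁.primeFactors) hl rfl
    ((mem_nset_iff_factoredNumbers hm₁).mp ha) (fun q hq _ => not_dvd_of_mem_nset hb hcop hq)
    heq.symm ((mem_nset_iff_factoredNumbers hm₁).mp ha')
    (fun q hq _ => not_dvd_of_mem_nset hb' hcop hq)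

/-- **A series over `𝔫(m₁m₂)` whose summand splits along `h = h₁h₂` is the product of the two series**
(`(m₁,m₂) = 1`; absolute convergence of the factors assumed). [folklore] -/
private theorem tsum_nset_mul_eq {m₁ m₂ : ℕ} (hm₁ : m₁ ≠ 0) (hcop : Nat.Coprime m₁ m₂)
    {F f₁ f₂ : ℕ → ℂ} (hF : ∀ h, h ∉ nset (m₁ * m₂) → F h = 0)
    (hf₁ : ∀ h, h ∉ nset m₁ → f₁ h = 0) (hf₂ : ∀ h, h ∉ nset m₂ → f₂ h = 0)
    (hsplit : ∀ h₁ h₂, h₁ ∈ nset m₁ → h₂ ∈ nset m₂ → F (h₁ * h₂) = f₁ h₁ * f₂ h₂)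
    (hs₁ : Summable fun h => ‖f₁ h‖) (hs₂ : Summable fun h => ‖f₂ h‖) :
    ∑' h, F h = (∑' h, f₁ h) * ∑' h, f₂ h := by
  rw [tsum_mul_tsum_of_summable_norm hs₁ hs₂]
  have mem₁ : ∀ {a b : ℕ}, f₁ a * f₂ b ≠ 0 → a ∈ nset m₁ := fun hab =>
    not_not.mp fun hn => hab (by rw [hf₁ _ hn, zero_mul])
  have mem₂ : ∀ {a b : ℕ}, f₁ a * f₂ b ≠ 0 → b ∈ nset m₂ := fun hab =>
    not_not.mp fun hn => hab (by rw [hf₂ _ hn, mul_zero])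
  refine tsum_eq_tsum_of_ne_zero_bij
    (fun z : Function.support (fun z : ℕ × ℕ => f₁ z.1 * f₂ z.2) => z.1.1 * z.1.2) ?_ ?_ ?_
  · rintro ⟨⟨a, b⟩, hab⟩ ⟨⟨a', b'⟩, hab'⟩ heq
    simp only at heq
    obtain ⟨rfl, rfl⟩ := split_nset_unique hm₁ hcop (mem₁ hab) (mem₂ hab) (mem₁ hab') (mem₂ hab') heq
    rfl
  · intro h hh
    have hmem : h ∈ nset (m₁ * m₂) := not_not.mp fun hn => hh (hF h hn)
    obtain ⟨a, b, hab, ha, hb⟩ := exists_split_nset hm₁ hmem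
    have hFab : F h = f₁ a * f₂ b := by rw [← hab]; exact hsplit a b ha hb
    have hne : f₁ a * f₂ b ≠ 0 := hFab ▸ hh
    exact ⟨⟨(a, b), hne⟩, hab⟩
  · rintro ⟨⟨a, b⟩, hab⟩
    exact hsplit a b (mem₁ hab) (mem₂ hab)

/-! ### `κ₂` bounded on `𝔫(m)`-multiples; absolute convergence of `κ̃₂(m;r,s)` for `σ > 0` -/

/-- `|κ₂(N)| ≤ 2^{ω(N)}` (`N ≥ 1`): `κ₂` is multiplicative with `|κ₂(qʲ)| ≤ 2`
(`AppendixA.norm_kappa₂_prime_pow_le_two`). [cite: Zhang2022LandauSiegel, App. A p.105] -/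
private theorem norm_kappa2_le_two_pow (D : ℕ) {N : ℕ} (hN : N ≠ 0) :
    ‖kappa2 c' D N‖ ≤ 2 ^ N.primeFactors.card := by
  have hmul := MeanSquareMajorant.isMultiplicative_kappa₂ (b1 c' D)
  unfold kappa2
  rw [hmul.multiplicative_factorization _ hN, Finsupp.prod, Nat.support_factorization, norm_prod]
  calc ∏ p ∈ N.primeFactors, ‖MeanSquareMajorant.kappa₂ (b1 c' D) (p ^ N.factorization p)‖
      ≤ ∏ _p ∈ N.primeFactors, (2 : ℝ) :=
        Finset.prod_le_prod (fun _ _ => norm_nonneg _) fun p hp =>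
          AppendixA.norm_kappa₂_prime_pow_le_two _ (Nat.prime_of_mem_primeFactors hp) _
    _ = 2 ^ N.primeFactors.card := Finset.prod_const 2

open scoped Classical in
/-- **The series `κ̃₂(m;r,s)` converges absolutely** for `m ≥ 1`, `Re s > 0`: on `𝔫(m)` the summand is
majorised by `2^{ω(m)}·h^{−σ}`, and `Σ_{h∈𝔫(m)} h^{−σ} = ∏_{q∣m}(1 − q^{−σ})⁻¹ < ∞` (Euler product over
the `m.primeFactors`-factored numbers). [cite: Zhang2022LandauSiegel, §16 p.90 (u013)] -/
theorem summable_norm_kappaTilde2_term {m : ℕ} (hm : m ≠ 0) (r : ℕ) {s : ℂ} (hs : 0 < s.re) :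
    Summable fun h : ℕ => ‖(if h ∈ nset m ∧ Nat.Coprime h r then
      kappa2 c' D (m * h) * χ (h : ZMod D) / (h : ℂ) ^ s else 0)‖ := by
  let f : ℕ →* ℝ :=
    { toFun := fun n => (n : ℝ) ^ (-s.re)
      map_one' := by simp
      map_mul' := fun a b => by
        push_cast
        exact Real.mul_rpow (Nat.cast_nonneg a) (Nat.cast_nonneg b) }
  have hf : ∀ n : ℕ, f n = (n : ℝ) ^ (-s.re) := fun n => rfl
  have hlt : ∀ {p : ℕ}, p.Prime → ‖f p‖ < 1 := by
    intro p hp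
    rw [hf, Real.norm_eq_abs, abs_of_nonneg (by positivity)]
    exact Real.rpow_lt_one_of_one_lt_of_neg (by exact_mod_cast hp.one_lt) (by linarith)
  obtain ⟨hsum, -⟩ :=
    EulerProduct.summable_and_hasSum_factoredNumbers_prod_filter_prime_geometric hlt m.primeFactors
  have hind : Summable ((Nat.factoredNumbers m.primeFactors).indicator fun h : ℕ => ‖f h‖) :=
    summable_subtype_iff_indicator.mp hsum
  refine Summable.of_nonneg_of_le (fun _ => norm_nonneg _) (fun h => ?_)
    (hind.mul_left (2 ^ m.primeFactors.card))
  by_cases hc : h ∈ nset m ∧ Nat.Coprime h r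
  · rw [if_pos hc]
    have hh0 : 0 < h := hc.1.1
    have hhR : (0 : ℝ) < h := by exact_mod_cast hh0
    have hmem : h ∈ Nat.factoredNumbers m.primeFactors := (mem_nset_iff_factoredNumbers hm).mp hc.1
    simp only [Set.indicator_of_mem hmem, hf, Real.norm_eq_abs,
      abs_of_nonneg (Real.rpow_nonneg (Nat.cast_nonneg h) _)]
    rw [norm_div, norm_mul, Complex.norm_natCast_cpow_of_pos hh0]
    have hκ : ‖kappa2 c' D (m * h)‖ ≤ 2 ^ m.primeFactors.card := by
      have h1 := norm_kappa2_le_two_pow c' D (mul_ne_zero hm hh0.ne')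
      rwa [primeFactors_mul_eq_of_mem_nset hm hc.1] at h1
    have hχ : ‖χ (h : ZMod D)‖ ≤ 1 := DirichletCharacter.norm_le_one χ _
    have hpow : (0 : ℝ) < (h : ℝ) ^ s.re := Real.rpow_pos_of_pos hhR _
    rw [div_le_iff₀ hpow]
    have hone : (h : ℝ) ^ (-s.re) * (h : ℝ) ^ s.re = 1 := by
      rw [Real.rpow_neg hhR.le, inv_mul_cancel₀ hpow.ne']
    calc ‖kappa2 c' D (m * h)‖ * ‖χ (h : ZMod D)‖ ≤ 2 ^ m.primeFactors.card * 1 :=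
          mul_le_mul hκ hχ (norm_nonneg _) (by positivity)
      _ = 2 ^ m.primeFactors.card * (h : ℝ) ^ (-s.re) * (h : ℝ) ^ s.re := by
          rw [mul_assoc, hone]
  · rw [if_neg hc, norm_zero]
    exact mul_nonneg (by positivity) (Set.indicator_nonneg (fun _ _ => norm_nonneg _) _)

/-! ### `κ̃₂` is multiplicative in `m` and insensitive to coprime extra factors of `r` -/

/-- **`κ̃₂(m₁m₂;r,s) = κ̃₂(m₁;r,s)·κ̃₂(m₂;r,s)`** for coprime `m₁, m₂ ≥ 1`, any `r`, `Re s > 0`: every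
`h ∈ 𝔫(m₁m₂)` is uniquely `h₁h₂` with `hᵢ ∈ 𝔫(mᵢ)`, `(h,r) = 1 ⇔ (h₁,r) = (h₂,r) = 1`, and
`κ₂(m₁m₂h₁h₂) = κ₂(m₁h₁)κ₂(m₂h₂)` (`κ₂` multiplicative, `(m₁h₁, m₂h₂) = 1`); both factor series converge
absolutely (`summable_norm_kappaTilde2_term`). The mechanism of "`ξ₂(n;d,l)` is a multiplicative
function of `n`" (§16 p.91). [cite: Zhang2022LandauSiegel, §16 p.91 (u020)] -/
theorem kappaTilde2_mul_of_coprime [NeZero D] {m₁ m₂ : ℕ} (hm₁ : m₁ ≠ 0) (hm₂ : m₂ ≠ 0)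
    (hcop : Nat.Coprime m₁ m₂) (r : ℕ) {s : ℂ} (hs : 0 < s.re) :
    kappaTilde2 c' χ (m₁ * m₂) r s = kappaTilde2 c' χ m₁ r s * kappaTilde2 c' χ m₂ r s := by
  classical
  have hmul := MeanSquareMajorant.isMultiplicative_kappa₂ (b1 c' D)
  unfold kappaTilde2
  refine tsum_nset_mul_eq hm₁ hcop (fun h hn => if_neg fun hc => hn hc.1)
    (fun h hn => if_neg fun hc => hn hc.1) (fun h hn => if_neg fun hc => hn hc.1)
    (fun h₁ h₂ hh₁ hh₂ => ?_)
    (summable_norm_kappaTilde2_term c' χ hm₁ r hs) (summable_norm_kappaTilde2_term c' χ hm₂ r hs)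
  have hmem : h₁ * h₂ ∈ nset (m₁ * m₂) := mul_mem_nset hh₁ hh₂
  by_cases hr₁ : Nat.Coprime h₁ r
  · by_cases hr₂ : Nat.Coprime h₂ r
    · rw [if_pos ⟨hmem, Nat.Coprime.mul_left hr₁ hr₂⟩, if_pos ⟨hh₁, hr₁⟩, if_pos ⟨hh₂, hr₂⟩]
      have hcop' : Nat.Coprime (m₁ * h₁) (m₂ * h₂) :=
        Nat.Coprime.mul_left
          (Nat.Coprime.mul_right hcop (coprime_of_mem_nset_of_mem_nset (self_mem_nset hm₁) hh₂ hcop))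
          (Nat.Coprime.mul_right (coprime_of_mem_nset_of_mem_nset hh₁ (self_mem_nset hm₂) hcop)
            (coprime_of_mem_nset_of_mem_nset hh₁ hh₂ hcop))
      have hκ : kappa2 c' D (m₁ * m₂ * (h₁ * h₂)) = kappa2 c' D (m₁ * h₁) * kappa2 c' D (m₂ * h₂) := by
        rw [show m₁ * m₂ * (h₁ * h₂) = (m₁ * h₁) * (m₂ * h₂) by ring]
        unfold kappa2
        exact hmul.map_mul_of_coprime hcop'
      have hpow : (((h₁ * h₂ : ℕ) : ℂ)) ^ s = (h₁ : ℂ) ^ s * (h₂ : ℂ) ^ s := by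
        push_cast
        exact Complex.natCast_mul_natCast_cpow h₁ h₂ s
      rw [hκ, hpow, Nat.cast_mul, map_mul χ, div_mul_div_comm]
      ring
    · have hn : ¬ (h₁ * h₂ ∈ nset (m₁ * m₂) ∧ Nat.Coprime (h₁ * h₂) r) :=
        fun hc => hr₂ (Nat.coprime_mul_iff_left.mp hc.2).2
      have hn₂ : ¬ (h₂ ∈ nset m₂ ∧ Nat.Coprime h₂ r) := fun hc => hr₂ hc.2
      rw [if_neg hn, if_neg hn₂, mul_zero]
  · have hn : ¬ (h₁ * h₂ ∈ nset (m₁ * m₂) ∧ Nat.Coprime (h₁ * h₂) r) :=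
      fun hc => hr₁ (Nat.coprime_mul_iff_left.mp hc.2).1
    have hn₁ : ¬ (h₁ ∈ nset m₁ ∧ Nat.Coprime h₁ r) := fun hc => hr₁ hc.2
    rw [if_neg hn, if_neg hn₁, zero_mul]

/-- **`κ̃₂(m;rk,s) = κ̃₂(m;r,s)` when `(m,k) = 1`**: on `𝔫(m)` the condition `(h,k) = 1` is automatic.
[cite: Zhang2022LandauSiegel, §16 p.90 (u013)] -/
theorem kappaTilde2_arg_mul_of_coprime [NeZero D] {m k : ℕ} (hmk : Nat.Coprime m k) (r : ℕ) (s : ℂ) :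
    kappaTilde2 c' χ m (r * k) s = kappaTilde2 c' χ m r s := by
  classical
  unfold kappaTilde2
  refine tsum_congr fun h => ?_
  by_cases hh : h ∈ nset m
  · have hk : Nat.Coprime h k := coprime_of_mem_nset hh hmk
    by_cases hr : Nat.Coprime h r
    · rw [if_pos ⟨hh, Nat.Coprime.mul_right hr hk⟩, if_pos ⟨hh, hr⟩]
    · rw [if_neg (fun hc => hr (Nat.coprime_mul_iff_right.mp hc.2).1), if_neg (fun hc => hr hc.2)]
  · rw [if_neg (fun hc => hh hc.1), if_neg (fun hc => hh hc.1)]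

/-- `κ̃₂(1;r,s) = 1` (`𝔫(1) = {1}`, `κ₂(1) = 1`). [cite: Zhang2022LandauSiegel, §16 p.90 (u013)] -/
theorem kappaTilde2_one_left [NeZero D] (r : ℕ) (s : ℂ) : kappaTilde2 c' χ 1 r s = 1 := by
  classical
  unfold kappaTilde2
  rw [tsum_eq_single 1]
  · have h1 : (1 : ℕ) ∈ nset 1 := self_mem_nset one_ne_zero
    rw [if_pos ⟨h1, Nat.coprime_one_left r⟩, mul_one]
    unfold kappa2
    rw [(MeanSquareMajorant.isMultiplicative_kappa₂ (b1 c' D)).map_one]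
    simp
  · intro h hh
    rw [if_neg]
    rintro ⟨⟨hpos, hdiv⟩, -⟩
    apply hh
    by_contra hne
    obtain ⟨p, hp, hph⟩ := Nat.exists_prime_and_dvd hne
    exact hp.one_lt.ne' (Nat.dvd_one.mp (hdiv p hp hph))

/-! ### `ξ₂(n;d,l)` is multiplicative in `n` -/

/-- The weight `μ(k)χ(k)k/φ(k)` of (16.7) is multiplicative in `k`. [cite: Zhang2022LandauSiegel, §16 (16.7) p.91] -/
private theorem moebChi_mul {k₁ k₂ : ℕ} (hk : Nat.Coprime k₁ k₂) :
    (ArithmeticFunction.moebius (k₁ * k₂) : ℂ) * χ ((k₁ * k₂ : ℕ) : ZMod D) * ((k₁ * k₂ : ℕ) : ℂ) /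
        (Nat.totient (k₁ * k₂) : ℂ) =
      ((ArithmeticFunction.moebius k₁ : ℂ) * χ (k₁ : ZMod D) * (k₁ : ℂ) / (Nat.totient k₁ : ℂ)) *
        ((ArithmeticFunction.moebius k₂ : ℂ) * χ (k₂ : ZMod D) * (k₂ : ℂ) / (Nat.totient k₂ : ℂ)) := by
  rw [ArithmeticFunction.isMultiplicative_moebius.map_mul_of_coprime hk, Nat.totient_mul hk,
    div_mul_div_comm]
  push_cast
  rw [map_mul]
  ring

/-- `ξ₂(1;d,l) = 1`. [cite: Zhang2022LandauSiegel, §16 (16.7) p.91] -/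
theorem xi2_one [NeZero D] (d l : ℕ) : xi2 c' χ 1 d l = 1 := by
  unfold xi2
  rw [Nat.divisors_one, Finset.filter_singleton, if_pos (Nat.coprime_one_left l),
    Finset.sum_singleton, Nat.div_self Nat.one_pos, mul_one, kappaTilde2_one_left]
  simp

/-- `ξ₂(0;d,l) = 0` (empty divisor sum; the typed `xi2` at the junk value `n = 0`). [folklore] -/
private theorem xi2_zero [NeZero D] (d l : ℕ) : xi2 c' χ 0 d l = 0 := by
  unfold xi2
  simp

/-- **`ξ₂(mn;d,l) = ξ₂(m;d,l)ξ₂(n;d,l)` for coprime `m, n`** ("It can be verified, for given `d` and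
`l`, that `ξ₂(n;d,l)` is a multiplicative function of `n`", §16 p.91): the divisors `k` of `mn` coprime
to `l` are the products `k₁k₂` of such divisors of `m` and `n`; the weight `μχ(k)k/φ(k)` is
multiplicative; and `κ̃₂(mn/(k₁k₂); dk₁k₂) = κ̃₂(m/k₁; dk₁)·κ̃₂(n/k₂; dk₂)` by
`kappaTilde2_mul_of_coprime` and `kappaTilde2_arg_mul_of_coprime` (`(m/k₁, k₂) = (n/k₂, k₁) = 1`).
[cite: Zhang2022LandauSiegel, §16 p.91 (u020)] -/
theorem xi2_mul_of_coprime [NeZero D] (d l : ℕ) {m n : ℕ} (hmn : Nat.Coprime m n) :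
    xi2 c' χ (m * n) d l = xi2 c' χ m d l * xi2 c' χ n d l := by
  rcases eq_or_ne m 0 with rfl | hm
  · rw [zero_mul, xi2_zero, zero_mul]
  rcases eq_or_ne n 0 with rfl | hn
  · rw [mul_zero, xi2_zero, mul_zero]
  unfold xi2
  rw [Finset.sum_filter, Finset.sum_filter, Finset.sum_filter, Nat.divisors_mul, Finset.mul_def,
    Finset.sum_image (Nat.Coprime.mul_injOn_divisors hmn), Finset.sum_product, Finset.sum_mul_sum]
  refine Finset.sum_congr rfl fun k₁ hk₁ => Finset.sum_congr rfl fun k₂ hk₂ => ?_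
  have hk₁m : k₁ ∣ m := (Nat.mem_divisors.mp hk₁).1
  have hk₂n : k₂ ∣ n := (Nat.mem_divisors.mp hk₂).1
  have hk₁0 : k₁ ≠ 0 := (Nat.pos_of_dvd_of_pos hk₁m (Nat.pos_of_ne_zero hm)).ne'
  have hk₂0 : k₂ ≠ 0 := (Nat.pos_of_dvd_of_pos hk₂n (Nat.pos_of_ne_zero hn)).ne'
  have hk : Nat.Coprime k₁ k₂ :=
    Nat.Coprime.coprime_dvd_left hk₁m (Nat.Coprime.coprime_dvd_right hk₂n hmn)
  simp only
  by_cases h₁ : Nat.Coprime k₁ l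
  · by_cases h₂ : Nat.Coprime k₂ l
    · rw [if_pos (Nat.Coprime.mul_left h₁ h₂), if_pos h₁, if_pos h₂, moebChi_mul χ hk]
      -- the `κ̃₂` factor
      have hq₁ : m / k₁ ≠ 0 := (Nat.div_pos (Nat.le_of_dvd (Nat.pos_of_ne_zero hm) hk₁m)
        (Nat.pos_of_ne_zero hk₁0)).ne'
      have hq₂ : n / k₂ ≠ 0 := (Nat.div_pos (Nat.le_of_dvd (Nat.pos_of_ne_zero hn) hk₂n)
        (Nat.pos_of_ne_zero hk₂0)).ne'
      have hcq : Nat.Coprime (m / k₁) (n / k₂) :=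
        Nat.Coprime.coprime_dvd_left (Nat.div_dvd_of_dvd hk₁m)
          (Nat.Coprime.coprime_dvd_right (Nat.div_dvd_of_dvd hk₂n) hmn)
      have hc₁ : Nat.Coprime (m / k₁) k₂ :=
        Nat.Coprime.coprime_dvd_left (Nat.div_dvd_of_dvd hk₁m) (Nat.Coprime.coprime_dvd_right hk₂n hmn)
      have hc₂ : Nat.Coprime (n / k₂) k₁ :=
        Nat.Coprime.coprime_dvd_left (Nat.div_dvd_of_dvd hk₂n)
          (Nat.Coprime.coprime_dvd_right hk₁m hmn.symm)
      have hK : kappaTilde2 c' χ (m * n / (k₁ * k₂)) (d * (k₁ * k₂)) 1 =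
          kappaTilde2 c' χ (m / k₁) (d * k₁) 1 * kappaTilde2 c' χ (n / k₂) (d * k₂) 1 := by
        rw [← Nat.div_mul_div_comm hk₁m hk₂n,
          kappaTilde2_mul_of_coprime c' χ hq₁ hq₂ hcq _ (by norm_num : (0 : ℝ) < (1 : ℂ).re),
          show d * (k₁ * k₂) = d * k₁ * k₂ by ring, kappaTilde2_arg_mul_of_coprime c' χ hc₁,
          show d * k₁ * k₂ = d * k₂ * k₁ by ring, kappaTilde2_arg_mul_of_coprime c' χ hc₂]
      rw [hK]
      ring
    · rw [if_neg (fun hc => h₂ (Nat.coprime_mul_iff_left.mp hc).2), if_neg h₂, mul_zero]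
  · rw [if_neg (fun hc => h₁ (Nat.coprime_mul_iff_left.mp hc).1), if_neg h₁, zero_mul]

/-- **u020 (multiplicativity) holds**: "`ξ₂(n;d,l)` is a multiplicative function of `n`" — `ξ₂(1) = 1` and
`ξ₂(mn) = ξ₂(m)ξ₂(n)` for coprime `m, n` (for every `D`, `χ`, `d`, `l`; no largeness needed). Node
`Z22:§16.u020` (prose part) DISCHARGED (kernel). [cite: Zhang2022LandauSiegel, §16 p.91 (u020)] -/
theorem step16_u020mult_holds : Step16_u020mult c' :=
  ⟨0, fun _ _ χ _ _ _ d l _ _ => ⟨xi2_one c' χ d l, fun _ _ hmn => xi2_mul_of_coprime c' χ d l hmn⟩⟩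

/-- `Step16_u020mult` — `_holds` alias of `step16_u020mult_holds` above under the fact's exact name (appended
2026-08-28, D-0026 bookkeeping: the proof term is the existing theorem of this file; no statement,
definition or attribute is edited; no new named fact; the ledger's debt table listed the fact
unproved). [cite: Zhang2022LandauSiegel, §16 p.91 (u020)] -/
theorem _root_.Literature.NumberTheory.LFunctions.Zhang2022.Typed.Section16A.Step16_u020mult_holds :
    Step16_u020mult c' :=
  _root_.Literature.NumberTheory.LFunctions.Zhang2022.Typed.Section16ALeaves.step16_u020mult_holds (c' := c')

end Mult

/-! ## u012: the Euler-product identity for `Σ_{(l,m)=1} κ₂(d₁l)χ(l)l^{−s}` (`σ > 1`) -/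

section EulerU012

open scoped LSeries.notation
open LSeries (term)

variable (c' : ℝ) {D : ℕ} (χ : DirichletCharacter ℂ D)

/-- `(q^e)^s = (q^s)^e` for naturals `q, e` and complex `s`. [folklore] -/
private theorem natCast_pow_cpow (q e : ℕ) (s : ℂ) : ((q ^ e : ℕ) : ℂ) ^ s = ((q : ℂ) ^ s) ^ e := by
  induction e with
  | zero => simp
  | succ e ih => rw [pow_succ, Nat.cast_mul, Complex.natCast_mul_natCast_cpow, ih, pow_succ]

/-- `‖q^{−s}‖ < 1` for a prime `q` and `Re s > 0`. [folklore] -/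
private theorem norm_natCast_cpow_neg_lt_one {q : ℕ} (hq : q.Prime) {s : ℂ} (hs : 0 < s.re) :
    ‖(q : ℂ) ^ (-s)‖ < 1 := by
  rw [Complex.norm_natCast_cpow_of_pos hq.pos, Complex.neg_re]
  exact Real.rpow_lt_one_of_one_lt_of_neg (by exact_mod_cast hq.one_lt) (by linarith)

/-- `‖χ(q)q^{−s}‖ < 1` for a prime `q` and `Re s > 0`. [folklore] -/
private theorem norm_chi_mul_cpow_neg_lt_one {q : ℕ} (hq : q.Prime) {s : ℂ} (hs : 0 < s.re) :
    ‖χ (q : ZMod D) * (q : ℂ) ^ (-s)‖ < 1 := by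
  rw [norm_mul]
  calc ‖χ (q : ZMod D)‖ * ‖(q : ℂ) ^ (-s)‖ ≤ 1 * ‖(q : ℂ) ^ (-s)‖ :=
        mul_le_mul_of_nonneg_right (DirichletCharacter.norm_le_one χ _) (norm_nonneg _)
    _ < 1 := by rw [one_mul]; exact norm_natCast_cpow_neg_lt_one hq hs

/-- An `L`-series dominated termwise by an absolutely convergent one converges absolutely. [folklore] -/
private theorem lseriesSummable_of_norm_le {f g : ℕ → ℂ} {s : ℂ} (hg : LSeriesSummable g s)
    (h : ∀ n, ‖f n‖ ≤ ‖g n‖) : LSeriesSummable f s := by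
  refine Summable.of_norm_bounded hg.norm fun n => ?_
  rcases eq_or_ne n 0 with rfl | hn
  · simp
  · rw [LSeries.term_of_ne_zero hn, LSeries.term_of_ne_zero hn, norm_div, norm_div]
    exact div_le_div_of_nonneg_right (h n) (norm_nonneg _)

/-! ### The twisted coefficients `χ(n)κ₂(n)`: multiplicativity of the `L`-series terms, local factors -/

/-- The `L`-series terms of `χκ₂` are multiplicative on coprime arguments (`χ` completely multiplicative,
`κ₂` multiplicative). [folklore] -/
private theorem term_chiKappa_mul_of_coprime (s : ℂ) {m n : ℕ} (hmn : Nat.Coprime m n) :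
    term (fun k => χ (k : ZMod D) * kappa2 c' D k) s (m * n) =
      term (fun k => χ (k : ZMod D) * kappa2 c' D k) s m *
        term (fun k => χ (k : ZMod D) * kappa2 c' D k) s n := by
  rcases eq_or_ne m 0 with rfl | hm
  · simp
  rcases eq_or_ne n 0 with rfl | hn
  · simp
  have hmul := MeanSquareMajorant.isMultiplicative_kappa₂ (b1 c' D)
  rw [LSeries.term_of_ne_zero (mul_ne_zero hm hn), LSeries.term_of_ne_zero hm,
    LSeries.term_of_ne_zero hn, Nat.cast_mul, Nat.cast_mul, map_mul χ,
    Complex.natCast_mul_natCast_cpow, div_mul_div_comm]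
  unfold kappa2
  rw [hmul.map_mul_of_coprime hmn]
  ring

/-- The `L`-series term of `χκ₂` at `1` is `1`. [folklore] -/
private theorem term_chiKappa_one (s : ℂ) : term (fun k => χ (k : ZMod D) * kappa2 c' D k) s 1 = 1 := by
  rw [LSeries.term_of_ne_zero one_ne_zero, Nat.cast_one, Nat.cast_one, map_one, Complex.one_cpow,
    div_one, one_mul]
  unfold kappa2
  exact (MeanSquareMajorant.isMultiplicative_kappa₂ (b1 c' D)).map_one

/-- The term of `χκ₂` at a prime power: `χ(qᵉ)κ₂(qᵉ)(qᵉ)^{−s} = κ₂(qᵉ)·(χ(q)q^{−s})ᵉ`. [folklore] -/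
private theorem term_chiKappa_prime_pow {q : ℕ} (hq : q.Prime) (s : ℂ) (e : ℕ) :
    term (fun k => χ (k : ZMod D) * kappa2 c' D k) s (q ^ e) =
      kappa2 c' D (q ^ e) * (χ (q : ZMod D) * (q : ℂ) ^ (-s)) ^ e := by
  rw [LSeries.term_of_ne_zero (pow_ne_zero e hq.ne_zero), div_eq_mul_inv, Nat.cast_pow, map_pow,
    natCast_pow_cpow, ← inv_pow, Complex.cpow_neg, mul_pow]
  ring

/-- **The local factor of `Σ κ₂(n)xⁿ`-type series**: `Σ_e κ₂(qᵉ)xᵉ = (1 − x)/(1 − q^{−ib₁}x)` for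
`‖x‖ < 1` (`κ₂(q^{j+1}) = w^j(w − 1)`, `w = q^{−ib₁}`, `AppendixA.kappa₂_apply_prime_pow_succ`) — the
reciprocal of the local factor of `λ₂` at `x = χ(q)q^{−s}`. [cite: Zhang2022LandauSiegel, §16 p.90 (u012, u014)] -/
private theorem tsum_kappa2_prime_pow_mul_pow {q : ℕ} (hq : q.Prime) {x : ℂ} (hx : ‖x‖ < 1) :
    ∑' e : ℕ, kappa2 c' D (q ^ e) * x ^ e =
      (1 - x) / (1 - MeanSquareMajorant.powI (b1 c' D) q * x) := by
  set w : ℂ := MeanSquareMajorant.powI (b1 c' D) q with hw_def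
  have hw : ‖w‖ = 1 := MeanSquareMajorant.norm_powI_of_pos (b1 c' D) hq.pos
  have hwx : ‖w * x‖ < 1 := by rw [norm_mul, hw, one_mul]; exact hx
  have hden : (1 : ℂ) - w * x ≠ 0 := by
    intro h
    have : ‖w * x‖ = 1 := by rw [← sub_eq_zero.mp h, norm_one]
    exact hwx.ne this
  -- summability (|κ₂(qᵉ)| ≤ 2)
  have hF : Summable fun e : ℕ => kappa2 c' D (q ^ e) * x ^ e := by
    refine Summable.of_norm_bounded ((summable_geometric_of_lt_one (norm_nonneg x) hx).mul_left 2)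
      fun e => ?_
    rw [norm_mul, norm_pow]
    unfold kappa2
    exact mul_le_mul_of_nonneg_right (AppendixA.norm_kappa₂_prime_pow_le_two _ hq e)
      (pow_nonneg (norm_nonneg x) e)
  rw [hF.tsum_eq_zero_add]
  have h0 : kappa2 c' D (q ^ 0) * x ^ 0 = 1 := by
    rw [pow_zero, pow_zero, mul_one]
    unfold kappa2
    exact (MeanSquareMajorant.isMultiplicative_kappa₂ (b1 c' D)).map_one
  have hsucc : ∀ e : ℕ, kappa2 c' D (q ^ (e + 1)) * x ^ (e + 1) = (w - 1) * x * (w * x) ^ e := by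
    intro e
    unfold kappa2
    rw [AppendixA.kappa₂_apply_prime_pow_succ (b1 c' D) hq e]
    rw [← hw_def]
    ring
  simp_rw [h0, hsucc]
  rw [tsum_mul_left, tsum_geometric_of_norm_lt_one hwx]
  field_simp
  ring

/-! ### Euler product over `𝔫(N)` and the series over the integers coprime to `N` -/

/-- **Euler product over `𝔫(N)`** for `χκ₂` (`Re s > 1`, `S` a finite set of primes):
`Σ_{h : primes of h ⊆ S} χ(h)κ₂(h)h^{−s} = ∏_{q ∈ S} Σ_e κ₂(qᵉ)(χ(q)q^{−s})ᵉ`. [folklore] -/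
private theorem hasSum_factoredNumbers_chiKappa {s : ℂ} (hs : 1 < s.re) {S : Finset ℕ}
    (hS : ∀ q ∈ S, q.Prime) :
    HasSum (fun m : Nat.factoredNumbers S => term (fun k => χ (k : ZMod D) * kappa2 c' D k) s m)
      (∏ q ∈ S, ∑' e : ℕ, kappa2 c' D (q ^ e) * (χ (q : ZMod D) * (q : ℂ) ^ (-s)) ^ e) := by
  have hκ : LSeriesSummable (fun k => χ (k : ZMod D) * kappa2 c' D k) s :=
    χ.LSeriesSummable_mul (MeanSquareMajorant.LSeriesSummable_kappa₂ (b1 c' D) hs)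
  have key := EulerProduct.summable_and_hasSum_factoredNumbers_prod_filter_prime_tsum
    (f := term (fun k => χ (k : ZMod D) * kappa2 c' D k) s) (term_chiKappa_one c' χ s)
    (fun hmn => term_chiKappa_mul_of_coprime c' χ s hmn)
    (fun hp => hκ.norm.comp_injective (Nat.pow_right_injective hp.two_le)) S
  have hfilter : S.filter Nat.Prime = S := Finset.filter_true_of_mem hS
  have hprod : (∏ q ∈ S, ∑' e : ℕ, term (fun k => χ (k : ZMod D) * kappa2 c' D k) s (q ^ e)) =
      ∏ q ∈ S, ∑' e : ℕ, kappa2 c' D (q ^ e) * (χ (q : ZMod D) * (q : ℂ) ^ (-s)) ^ e :=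
    Finset.prod_congr rfl fun q hq => tsum_congr fun e => term_chiKappa_prime_pow c' χ (hS q hq) s e
  rw [hfilter, hprod] at key
  exact key.2

/-- `q^{−ib₁}·(χ(q)q^{−s}) = χ(q)q^{−(s+β₁)}` (`β₁ = ib₁`). [cite: Zhang2022LandauSiegel, §2 (2.13)] -/
private theorem powI_mul_chi_cpow {q : ℕ} (hq : q.Prime) (s : ℂ) :
    MeanSquareMajorant.powI (b1 c' D) q * (χ (q : ZMod D) * (q : ℂ) ^ (-s)) =
      χ (q : ZMod D) * (q : ℂ) ^ (-(s + beta1 c' D)) := by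
  have hq0 : (q : ℂ) ≠ 0 := by exact_mod_cast hq.ne_zero
  rw [MeanSquareMajorant.powI_apply_of_ne_zero _ hq.ne_zero, beta1_eq_b1_mul_I,
    show -(s + (b1 c' D : ℂ) * I) = -((b1 c' D : ℂ) * I) + -s by ring, Complex.cpow_add _ _ hq0]
  ring

/-- **`Σ_{h∈𝔫(N)} χ(h)κ₂(h)h^{−s}` as an Euler product** (`N ≥ 1`, `Re s > 1`):
`= ∏_{q∣N} (1 − χ(q)q^{−s})/(1 − χ(q)q^{−(s+β₁)})` — the reciprocal of `λ₂(N,s)`.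
[cite: Zhang2022LandauSiegel, §16 p.90 (u012, u014)] -/
theorem LSeries_indicator_nset_chiKappa {s : ℂ} (hs : 1 < s.re) {N : ℕ} (hN : N ≠ 0) :
    LSeries ((nset N).indicator fun k => χ (k : ZMod D) * kappa2 c' D k) s =
      ∏ q ∈ N.primeFactors, (1 - χ (q : ZMod D) * (q : ℂ) ^ (-s)) /
        (1 - χ (q : ZMod D) * (q : ℂ) ^ (-(s + beta1 c' D))) := by
  have hS : ∀ q ∈ N.primeFactors, q.Prime := fun q hq => Nat.prime_of_mem_primeFactors hq
  have hprod : (∏ q ∈ N.primeFactors, ∑' e : ℕ, kappa2 c' D (q ^ e) * (χ (q : ZMod D) * (q : ℂ) ^ (-s)) ^ e) =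
      ∏ q ∈ N.primeFactors, (1 - χ (q : ZMod D) * (q : ℂ) ^ (-s)) /
        (1 - χ (q : ZMod D) * (q : ℂ) ^ (-(s + beta1 c' D))) := by
    refine Finset.prod_congr rfl fun q hq => ?_
    rw [tsum_kappa2_prime_pow_mul_pow c' (hS q hq) (norm_chi_mul_cpow_neg_lt_one χ (hS q hq) (by linarith)),
      powI_mul_chi_cpow c' χ (hS q hq)]
  rw [← hprod, ← (hasSum_factoredNumbers_chiKappa c' χ hs hS).tsum_eq,
    tsum_subtype (Nat.factoredNumbers N.primeFactors)
      (term (fun k => χ (k : ZMod D) * kappa2 c' D k) s), LSeries]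
  refine tsum_congr fun n => ?_
  by_cases hn : n ∈ nset N
  · have hn' : n ∈ Nat.factoredNumbers N.primeFactors := (mem_nset_iff_factoredNumbers hN).mp hn
    have hn0 : n ≠ 0 := hn.1.ne'
    rw [Set.indicator_of_mem hn', LSeries.term_of_ne_zero hn0, LSeries.term_of_ne_zero hn0,
      Set.indicator_of_mem hn]
  · have hn' : n ∉ Nat.factoredNumbers N.primeFactors :=
      fun h => hn ((mem_nset_iff_factoredNumbers hN).mpr h)
    rw [Set.indicator_of_notMem hn']
    rcases eq_or_ne n 0 with rfl | hn0
    · simp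
    · rw [LSeries.term_of_ne_zero hn0, Set.indicator_of_notMem hn, zero_div]

/-- The indicator of `𝔫(N)` vanishes off the `N.primeFactors`-factored numbers. [folklore] -/
private theorem indicator_nset_eq_zero {N : ℕ} (hN : N ≠ 0) (g : ℕ → ℂ) {a : ℕ}
    (ha : a ∉ Nat.factoredNumbers N.primeFactors) : (nset N).indicator g a = 0 :=
  Set.indicator_of_notMem (fun h => ha ((mem_nset_iff_factoredNumbers hN).mp h)) g

/-- The indicator of "coprime to `N`" vanishes on multiples of primes of `N`. [folklore] -/
private theorem indicator_coprime_eq_zero {N : ℕ} (g : ℕ → ℂ) {b q : ℕ} (hq : q ∈ N.primeFactors)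
    (hqb : q ∣ b) : {r | Nat.Coprime r N}.indicator g b = 0 := by
  refine Set.indicator_of_notMem (fun hb => ?_) g
  have hq' := Nat.mem_primeFactors.mp hq
  have h1 : q ∣ Nat.gcd b N := Nat.dvd_gcd hqb hq'.2.1
  rw [Set.mem_setOf_eq.mp hb] at h1
  exact hq'.1.one_lt.ne' (Nat.dvd_one.mp h1)

/-- **`χκ₂ = (χκ₂)𝟙_{𝔫(N)} ∗ (χκ₂)𝟙_{(·,N)=1}`** (unique splitting `n = hr`). [folklore] -/
private theorem indicator_nset_conv_indicator_coprime {N : ℕ} (hN : N ≠ 0) {n : ℕ} (hn : n ≠ 0) :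
    (((nset N).indicator fun k => χ (k : ZMod D) * kappa2 c' D k) ⍟
        ({r | Nat.Coprime r N}.indicator fun k => χ (k : ZMod D) * kappa2 c' D k)) n =
      χ (n : ZMod D) * kappa2 c' D n := by
  have hmul := MeanSquareMajorant.isMultiplicative_kappa₂ (b1 c' D)
  obtain ⟨a, b, hab, ha, hb⟩ := KappaEuler.exists_split N.primeFactors hn
  rw [KappaEuler.convolution_eq_of_split (fun a ha => indicator_nset_eq_zero hN _ ha)
    (fun b q hq _ hqb => indicator_coprime_eq_zero _ hq hqb) hn hab ha hb]
  have hbN : Nat.Coprime b N := KappaEuler.coprime_of_split' hb hN subset_rfl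
  have hba : Nat.Coprime b a := KappaEuler.coprime_of_split hb ha
  rw [Set.indicator_of_mem ((mem_nset_iff_factoredNumbers hN).mpr ha), Set.indicator_of_mem (by exact hbN),
    ← hab, Nat.cast_mul, map_mul χ]
  unfold kappa2
  rw [hmul.map_mul_of_coprime hba.symm]
  ring

/-- **`L(χκ₂, s) = L(s+β₁,χ)/L(s,χ)`** (`Re s > 1`; the tree's `MeanSquareMajorant.LSeries_twist_kappa₂`
in the §16 parametrisation). [cite: Zhang2022LandauSiegel, §16 p.89 (u006)] -/
theorem LSeries_chiKappa {s : ℂ} (hs : 1 < s.re) :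
    LSeries (fun k => χ (k : ZMod D) * kappa2 c' D k) s =
      LSeries (fun n => χ (n : ZMod D)) (s + (b1 c' D : ℂ) * I) / LSeries (fun n => χ (n : ZMod D)) s :=
  MeanSquareMajorant.LSeries_twist_kappa₂ (b1 c' D) χ hs

/-- **`Σ_{(r,N)=1} χ(r)κ₂(r)r^{−s}` via the Euler product** (`N ≥ 1`, `Re s > 1`):
`(Σ_{(r,N)=1} …)·∏_{q∣N}(1 − χ(q)q^{−s})/(1 − χ(q)q^{−(s+β₁)}) = L(χκ₂, s)`. [cite: Zhang2022LandauSiegel, §16 p.90 (u012)] -/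
theorem LSeries_indicator_coprime_mul {s : ℂ} (hs : 1 < s.re) {N : ℕ} (hN : N ≠ 0) :
    LSeries ({r | Nat.Coprime r N}.indicator fun k => χ (k : ZMod D) * kappa2 c' D k) s *
        ∏ q ∈ N.primeFactors, (1 - χ (q : ZMod D) * (q : ℂ) ^ (-s)) /
          (1 - χ (q : ZMod D) * (q : ℂ) ^ (-(s + beta1 c' D))) =
      LSeries (fun k => χ (k : ZMod D) * kappa2 c' D k) s := by
  have hκ : LSeriesSummable (fun k => χ (k : ZMod D) * kappa2 c' D k) s :=
    χ.LSeriesSummable_mul (MeanSquareMajorant.LSeriesSummable_kappa₂ (b1 c' D) hs)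
  have hC : LSeriesSummable ((nset N).indicator fun k => χ (k : ZMod D) * kappa2 c' D k) s :=
    lseriesSummable_of_norm_le hκ fun n => norm_indicator_le_norm_self _ _
  have hB : LSeriesSummable ({r | Nat.Coprime r N}.indicator fun k => χ (k : ZMod D) * kappa2 c' D k) s :=
    lseriesSummable_of_norm_le hκ fun n => norm_indicator_le_norm_self _ _
  rw [← LSeries_indicator_nset_chiKappa c' χ hs hN, mul_comm, ← LSeries_convolution' hC hB]
  exact LSeries_congr (fun hn => indicator_nset_conv_indicator_coprime c' χ hN hn) s

/-- **`λ₂(N,s)` is the reciprocal of the Euler product over `q ∣ N`** (`Re s > 0`):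
`λ₂(N,s)·∏_{q∣N}(1 − χ(q)q^{−s})/(1 − χ(q)q^{−(s+β₁)}) = 1`. [cite: Zhang2022LandauSiegel, §16 p.90 (u014)] -/
theorem lam2_mul_prod_eq_one {s : ℂ} (hs : 0 < s.re) (N : ℕ) [NeZero D] :
    lam2 c' χ N s * ∏ q ∈ N.primeFactors, (1 - χ (q : ZMod D) * (q : ℂ) ^ (-s)) /
        (1 - χ (q : ZMod D) * (q : ℂ) ^ (-(s + beta1 c' D))) = 1 := by
  unfold lam2
  rw [← Finset.prod_mul_distrib]
  refine Finset.prod_eq_one fun q hq => ?_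
  have hq' : q.Prime := Nat.prime_of_mem_primeFactors hq
  have hx : ‖χ (q : ZMod D) * (q : ℂ) ^ (-s)‖ < 1 := norm_chi_mul_cpow_neg_lt_one χ hq' hs
  have hy : ‖χ (q : ZMod D) * (q : ℂ) ^ (-(s + beta1 c' D))‖ < 1 := by
    refine norm_chi_mul_cpow_neg_lt_one χ hq' ?_
    rw [Complex.add_re, beta1_eq_b1_mul_I, Complex.mul_re, Complex.ofReal_re, Complex.ofReal_im,
      Complex.I_re, Complex.I_im]
    simpa using hs
  have h1 : (1 : ℂ) - χ (q : ZMod D) * (q : ℂ) ^ (-s) ≠ 0 := by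
    intro h; exact hx.ne (by rw [← sub_eq_zero.mp h, norm_one])
  have h2 : (1 : ℂ) - χ (q : ZMod D) * (q : ℂ) ^ (-(s + beta1 c' D)) ≠ 0 := by
    intro h; exact hy.ne (by rw [← sub_eq_zero.mp h, norm_one])
  field_simp

/-- **`Σ_{(r,N)=1} χ(r)κ₂(r)r^{−s} = λ₂(N,s)·L(s+β₁,χ)/L(s,χ)`** (`N ≥ 1`, `Re s > 1`, `L`-series
form). [cite: Zhang2022LandauSiegel, §16 p.90 (u012)] -/
theorem LSeries_indicator_coprime_chiKappa [NeZero D] {s : ℂ} (hs : 1 < s.re) {N : ℕ} (hN : N ≠ 0) :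
    LSeries ({r | Nat.Coprime r N}.indicator fun k => χ (k : ZMod D) * kappa2 c' D k) s =
      lam2 c' χ N s * (LSeries (fun n => χ (n : ZMod D)) (s + (b1 c' D : ℂ) * I) /
        LSeries (fun n => χ (n : ZMod D)) s) := by
  have key := LSeries_indicator_coprime_mul c' χ hs hN
  have hlam := lam2_mul_prod_eq_one c' χ (by linarith : 0 < s.re) N
  rw [← LSeries_chiKappa c' χ hs, ← key]
  set P := ∏ q ∈ N.primeFactors, (1 - χ (q : ZMod D) * (q : ℂ) ^ (-s)) /
    (1 - χ (q : ZMod D) * (q : ℂ) ^ (-(s + beta1 c' D)))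
  calc LSeries ({r | Nat.Coprime r N}.indicator fun k => χ (k : ZMod D) * kappa2 c' D k) s
      = (lam2 c' χ N s * P) *
          LSeries ({r | Nat.Coprime r N}.indicator fun k => χ (k : ZMod D) * kappa2 c' D k) s := by
        rw [hlam, one_mul]
    _ = _ := by ring

/-! ### The splitting `l = hr` and the node -/

/-- The `L`-series of `h ↦ 𝟙[h ∈ 𝔫(d₁), (h,m)=1]χ(h)κ₂(d₁h)` is `κ̃₂(d₁;m,s)` (termwise).
[cite: Zhang2022LandauSiegel, §16 p.90 (u013)] -/
theorem LSeries_eq_kappaTilde2 [NeZero D] (d₁ m : ℕ) (s : ℂ) :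
    LSeries ({h | h ∈ nset d₁ ∧ Nat.Coprime h m}.indicator
        fun h => χ (h : ZMod D) * kappa2 c' D (d₁ * h)) s = kappaTilde2 c' χ d₁ m s := by
  classical
  unfold kappaTilde2
  rw [LSeries]
  refine tsum_congr fun h => ?_
  by_cases hh : h ∈ nset d₁ ∧ Nat.Coprime h m
  · rw [if_pos hh, LSeries.term_of_ne_zero hh.1.1.ne', Set.indicator_of_mem (by exact hh), mul_comm]
  · rw [if_neg hh]
    rcases eq_or_ne h 0 with rfl | h0
    · simp
    · rw [LSeries.term_of_ne_zero h0, Set.indicator_of_notMem (by exact hh), zero_div]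

open scoped Classical in
/-- Absolute convergence of that series for `Re s > 0` (`summable_norm_kappaTilde2_term`). [folklore] -/
private theorem lseriesSummable_kappaTilde2 [NeZero D] {s : ℂ} (hs : 0 < s.re) {d₁ : ℕ} (hd₁ : d₁ ≠ 0)
    (m : ℕ) :
    LSeriesSummable ({h | h ∈ nset d₁ ∧ Nat.Coprime h m}.indicator
      fun h => χ (h : ZMod D) * kappa2 c' D (d₁ * h)) s := by
  refine (summable_norm_kappaTilde2_term c' χ hd₁ m hs).of_norm.congr fun h => ?_
  by_cases hh : h ∈ nset d₁ ∧ Nat.Coprime h m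
  · rw [if_pos hh, LSeries.term_of_ne_zero hh.1.1.ne', Set.indicator_of_mem (by exact hh), mul_comm]
  · rw [if_neg hh]
    rcases eq_or_ne h 0 with rfl | h0
    · simp
    · rw [LSeries.term_of_ne_zero h0, Set.indicator_of_notMem (by exact hh), zero_div]

/-- **The splitting behind u012**: for `l ≥ 1`,
`𝟙[(l,m)=1]χ(l)κ₂(d₁l) = (𝟙[h∈𝔫(d₁),(h,m)=1]χ(h)κ₂(d₁h) ∗ 𝟙[(r,d₁m)=1]χ(r)κ₂(r))(l)` — every `l` coprime
to `m` is uniquely `hr` with `h ∈ 𝔫(d₁)`, `(h,m) = 1`, `(r, d₁m) = 1`, and `κ₂(d₁hr) = κ₂(d₁h)κ₂(r)`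
(the §7 p.40 mechanism, `KappaEuler.exists_split`). [cite: Zhang2022LandauSiegel, §16 p.90 (u012); §7 p.40] -/
theorem split_conv_apply {d₁ m : ℕ} (hd₁ : d₁ ≠ 0) (hm : m ≠ 0) {l : ℕ} (hl : l ≠ 0) :
    (({h | h ∈ nset d₁ ∧ Nat.Coprime h m}.indicator fun h => χ (h : ZMod D) * kappa2 c' D (d₁ * h)) ⍟
        ({r | Nat.Coprime r (d₁ * m)}.indicator fun k => χ (k : ZMod D) * kappa2 c' D k)) l =
      if Nat.Coprime l m then χ (l : ZMod D) * kappa2 c' D (d₁ * l) else 0 := by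
  have hmul := MeanSquareMajorant.isMultiplicative_kappa₂ (b1 c' D)
  obtain ⟨a, b, hab, ha, hb⟩ := KappaEuler.exists_split d₁.primeFactors hl
  have hA : ∀ a, a ∉ Nat.factoredNumbers d₁.primeFactors →
      {h | h ∈ nset d₁ ∧ Nat.Coprime h m}.indicator
        (fun h => χ (h : ZMod D) * kappa2 c' D (d₁ * h)) a = 0 := fun a ha =>
    Set.indicator_of_notMem (fun h => ha ((mem_nset_iff_factoredNumbers hd₁).mp h.1)) _
  have hB : ∀ b, ∀ q ∈ d₁.primeFactors, q.Prime → q ∣ b →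
      {r | Nat.Coprime r (d₁ * m)}.indicator (fun k => χ (k : ZMod D) * kappa2 c' D k) b = 0 :=
    fun b q hq _ hqb => indicator_coprime_eq_zero _
      (Nat.primeFactors_mono (dvd_mul_right d₁ m) (mul_ne_zero hd₁ hm) hq) hqb
  rw [KappaEuler.convolution_eq_of_split hA hB hl hab ha hb]
  have had : Nat.Coprime b d₁ := KappaEuler.coprime_of_split' hb hd₁ subset_rfl
  have hba : Nat.Coprime b a := KappaEuler.coprime_of_split hb ha
  have ha' : a ∈ nset d₁ := (mem_nset_iff_factoredNumbers hd₁).mpr ha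
  by_cases hlm : Nat.Coprime l m
  · have ham : Nat.Coprime a m := Nat.Coprime.coprime_dvd_left ⟨b, hab.symm⟩ hlm
    have hbm : Nat.Coprime b m :=
      Nat.Coprime.coprime_dvd_left ⟨a, by rw [mul_comm]; exact hab.symm⟩ hlm
    have hbdm : Nat.Coprime b (d₁ * m) := Nat.Coprime.mul_right had hbm
    rw [if_pos hlm, Set.indicator_of_mem (show a ∈ {h | h ∈ nset d₁ ∧ Nat.Coprime h m} from
      ⟨ha', ham⟩), Set.indicator_of_mem (show b ∈ {r | Nat.Coprime r (d₁ * m)} from hbdm),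
      ← hab, Nat.cast_mul, map_mul χ, ← mul_assoc d₁ a b]
    unfold kappa2
    rw [hmul.map_mul_of_coprime (show Nat.Coprime (d₁ * a) b from
      Nat.Coprime.mul_left had.symm hba.symm)]
    ring
  · rw [if_neg hlm]
    by_cases ham : Nat.Coprime a m
    · have hbm : ¬ Nat.Coprime b m := fun hbm => hlm (hab ▸ Nat.Coprime.mul_left ham hbm)
      rw [Set.indicator_of_notMem (show b ∉ {r | Nat.Coprime r (d₁ * m)} from
        fun h => hbm (Nat.Coprime.coprime_mul_left_right h)), mul_zero]
    · rw [Set.indicator_of_notMem (show a ∉ {h | h ∈ nset d₁ ∧ Nat.Coprime h m} from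
        fun h => ham h.2), zero_mul]

/-- `kap2Ser` is the `L`-series of `l ↦ 𝟙[(l,m)=1]χ(l)κ₂(d₁l)` (termwise; the `l = 0` term vanishes
on both sides as `κ₂(0) = 0`). [cite: Zhang2022LandauSiegel, §16 (16.4) p.90] -/
theorem kap2Ser_eq_LSeries [NeZero D] (d₁ m : ℕ) (s : ℂ) :
    kap2Ser c' χ d₁ m s =
      LSeries (fun l => if Nat.Coprime l m then χ (l : ZMod D) * kappa2 c' D (d₁ * l) else 0) s := by
  unfold kap2Ser
  rw [LSeries]
  refine tsum_congr fun l => ?_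
  rcases eq_or_ne l 0 with rfl | hl
  · simp [LSeries.term]
  · rw [LSeries.term_of_ne_zero hl]
    by_cases hc : Nat.Coprime l m
    · rw [if_pos hc, if_pos hc, mul_comm (χ _)]
    · rw [if_neg hc, if_neg hc, zero_div]

/-- **u012 holds** (§16 p.90, tex L4470): for `σ > 1`,
`Σ_{(l₁,d₂k)=1} κ₂(d₁l₁)χ(l₁)/l₁^s = κ̃₂(d₁;d₂k,s)·λ₂(d₁d₂k,s)·L(s+β₁,χ)/L(s,χ)` — the splitting `l = hr`
(`split_conv_apply`), `L`-series of a Dirichlet convolution = product (`LSeries_convolution'`), the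
Euler-product evaluation `Σ_{(r,N)=1}χκ₂(r)r^{−s} = λ₂(N,s)L(χκ₂,s)` (`LSeries_indicator_coprime_chiKappa`),
`L(χκ₂,s) = L(s+β₁,χ)/L(s,χ)` (`MeanSquareMajorant.LSeries_twist_kappa₂`) and Mathlib's
`DirichletCharacter.LFunction_eq_LSeries` (`σ > 1`). Node `Z22:§16.u012` DISCHARGED (kernel; every `D`,
`χ` — the hypotheses "quadratic, primitive" of the typed claim are not used).
[cite: Zhang2022LandauSiegel, §16 p.90 (u012)] -/
theorem step16_u012_holds : Step16_u012 c' := by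
  intro D _ χ _ _ d₁ m hd₁ hm s hs
  have hd0 : d₁ ≠ 0 := by omega
  have hm0 : m ≠ 0 := by omega
  have hκ : LSeriesSummable (fun k => χ (k : ZMod D) * kappa2 c' D k) s :=
    χ.LSeriesSummable_mul (MeanSquareMajorant.LSeriesSummable_kappa₂ (b1 c' D) hs)
  have hA := lseriesSummable_kappaTilde2 c' χ (by linarith : 0 < s.re) hd0 m
  have hB : LSeriesSummable
      ({r | Nat.Coprime r (d₁ * m)}.indicator fun k => χ (k : ZMod D) * kappa2 c' D k) s :=
    lseriesSummable_of_norm_le hκ fun n => norm_indicator_le_norm_self _ _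
  have hre : 1 < (s + beta1 c' D).re := by
    rw [Complex.add_re, beta1_eq_b1_mul_I, Complex.mul_re, Complex.ofReal_re, Complex.ofReal_im,
      Complex.I_re, Complex.I_im]
    simpa using hs
  rw [DirichletCharacter.LFunction_eq_LSeries χ hre, DirichletCharacter.LFunction_eq_LSeries χ hs,
    beta1_eq_b1_mul_I, kap2Ser_eq_LSeries, ← LSeries_eq_kappaTilde2, mul_assoc,
    ← LSeries_indicator_coprime_chiKappa c' χ hs (mul_ne_zero hd0 hm0), ← LSeries_convolution' hA hB]
  exact LSeries_congr (fun hl => (split_conv_apply c' χ hd0 hm0 hl).symm) s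

/-- `Step16_u012` — `_holds` alias of `step16_u012_holds` above under the fact's exact name (appended
2026-08-28, D-0026 bookkeeping: the proof term is the existing theorem of this file; no statement,
definition or attribute is edited; no new named fact; the ledger's debt table listed the fact
unproved). [cite: Zhang2022LandauSiegel, §16 p.90 (u012)] -/
theorem _root_.Literature.NumberTheory.LFunctions.Zhang2022.Typed.Section16A.Step16_u012_holds :
    Step16_u012 c' :=
  _root_.Literature.NumberTheory.LFunctions.Zhang2022.Typed.Section16ALeaves.step16_u012_holds (c' := c')

end EulerU012

end Literature.NumberTheory.LFunctions.Zhang2022.Typed.Section16ALeaves
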